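import Mathlib
import HarnessLib
import HarnessLib.Audit
import Summits.NavierStokesRegularity.Statement
import Literature.Analysis.FluidPDE.ClassicalSolution
import Literature.Analysis.FluidPDE.LerayHopf
import Literature.Analysis.FluidPDE.SuitableWeak
import Literature.Analysis.FluidPDE.SelfSimilar
import Literature.Analysis.FluidPDE.WeakSolution
import Literature.Analysis.FluidPDE.VectorCalculus
import Literature.Analysis.FluidPDE.MildSolution
import Literature.Analysis.FluidPDE.NSWave0
import Literature.Analysis.UnboundedOperators.HeatKernel
import Summits.NavierStokesRegularity.NavierStokesRegularity.Theorems.TypeICertificateLadderNoBlowupToClay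
import Summits.NavierStokesRegularity.NavierStokesRegularity.Theorems.SqueezeCycleShearEndpoint
import Summits.NavierStokesRegularity.NavierStokesRegularity.Theorems.SqueezeCycleBiaxialityDefect
import Summits.NavierStokesRegularity.NavierStokesRegularity.Theorems.SqueezeCycleSignLaw
import Summits.NavierStokesRegularity.NavierStokesRegularity.Theorems.SqueezeCycleMiddleEigenvalueSign
import Summits.NavierStokesRegularity.NavierStokesRegularity.Theorems.SqueezeCycleAssemblyFrame

/-!
Route: SqueezeCycle

DORMANT since 2026-09-04T10:54:11Z (reconciler: no traction for 5 d (last activity statement-claimed at 2026-08-30T10:20:50Z); parked, not closed — `ledger route dormant route-NavierStokesRegularity-SqueezeCycle --off` to reactivate) — unstaffed, not closed; items shared with open routes are served there. `ledger route dormant <id> --off` reactivates.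

# Route SqueezeCycle — to blow up you must squeeze — a middle-eigenvalue Liouville dichotomy on the
Type-I model class

It suffices to show X = SqueezeLiouville: for every C, every element u of the TYPE-I MODEL CLASS 𝒦_C
— smooth divergence-free
KNSS-mild ancient solutions of Navier–Stokes (ν = 1) on ℝ³×(−∞,0) (Oseen integral equation, kernel
written out through
`UnboundedOperators.heatKernel` exactly as in route ClockStretchingLaw rev 2) with the Type-I
sup-rate |u| ≤ C/√(−t) and scale-invariant
local energies A, E ≤ C (Albritton–Barker's class) — vanishes identically on t < 0. Card
squeeze-cycle-middle-eigenvalue splits X by ONE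
scale-invariant pointwise observable, the LERAY-GAUGE MIDDLE STRAIN EIGENVALUE Λ_u(t,x) :=
(−t)·λ₂(sym ∇u(t,x)) (typed by Courant–Fischer:
'Λ ≤ a' ⇔ the quadratic form of (−t)∇u is ≤ a|·|² on some 2-plane), at the threshold 1/8 < 1/4:
X ⇐ MustSqueeze (Λ ≤ 1/8 everywhere ⇒ u ≡ 0: the middle-eigenvalue SIGN LAW ω·Sω = 4det∇u − 4det S
made ancient) ∧ ExtremalElementExists
(compactness of 𝒦_C: if Λ > 1/8 somewhere, the supremum of Λ over the whole class is attained) ∧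
ExtremalBiaxialitySubcritical (the attained
maximum is < 1/8: 'pancakes cannot squeeze themselves and nobody squeezes in a circle' — the
squeeze-cycle exclusion, one typed node now,
the card's K1–K3 as its layer-2 split). X implies NoSingularTypeIModel of route ClockStretchingLaw
(stmt-NavierStokesRegularity-10569)
trivially; SingularZoom (shared stmt-10573), NoTypeII (shared stmt-0056) and NoBlowupToClay (shared
stmt-0055) finish Clay (A).
Lean: `∀ (C : ℝ) (u : ℝ → EuclideanSpace ℝ (Fin 3) → EuclideanSpace ℝ (Fin 3)), ContDiffOn ℝ (⊤ :
ℕ∞) (Function.uncurry u) (Set.Iio 0 ×ˢ Set.univ) ∧ (∀ t < 0,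
Literature.Analysis.FluidPDE.VectorCalculus.IsDivFree (u t)) ∧ (∀ s t : ℝ, s < t → t < 0 → ∀ x, u t
x = Literature.Analysis.FluidPDE.heatFlow (u s) (t-s) x - ∫ τ in Set.Ioo s t, ∫ y, ((-(inner ℝ (x-y)
(u τ y) / (2*(t-τ)) * Literature.Analysis.UnboundedOperators.heatKernel (t-τ) (x-y))) • u τ y + (∫ σ
in Set.Ioi (t-τ), Literature.Analysis.UnboundedOperators.heatKernel σ (x-y) / (4*σ^2)) • (inner ℝ
(x-y) (u τ y) • u τ y + inner ℝ (u τ y) (u τ y) • (x-y) + inner ℝ (x-y) (u τ y) • u τ y) - ((∫ σ in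
Set.Ioi (t-τ), Literature.Analysis.UnboundedOperators.heatKernel σ (x-y) / (8*σ^3)) * (inner ℝ (x-y)
(u τ y) * inner ℝ (x-y) (u τ y))) • (x-y))) ∧ Literature.Analysis.FluidPDE.HasTypeITimeDecay C u ∧
(∀ (x₀ : EuclideanSpace ℝ (Fin 3)) (t₀ r : ℝ), t₀ ≤ 0 → 0 < r → (∀ t, t₀ - r^2 < t → t < t₀ → r⁻¹ *
∫ x in Metric.ball x₀ r, ‖u t x‖^2 ≤ C) ∧ r⁻¹ * ∫ t in Set.Ioo (t₀ - r^2) t₀, ∫ x in Metric.ball x₀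
r, ‖fderiv ℝ (u t) x‖^2 ≤ C) → ∀ t < 0, ∀ x, u t x = 0`

## Assembly
Pure logic (Sketch.lean / glue.lean `closes`, lean check rc 0, 0 sorries). Step 1: for u ∈ 𝒦_C,
either Λ_u ≤ 1/8 at every point —
then MustSqueeze gives u ≡ 0 — or some point violates it; then ExtremalElementExists produces an
extremal (u′, m ≥ 1/8, (t₀,x₀)) and
ExtremalBiaxialitySubcritical gives m < 1/8, absurd: so X = SqueezeLiouville. Step 2 (shared tail of
route ClockStretchingLaw): apply
NoBlowupToClay; a finite-energy classical solution from a rapidly decaying datum with no smooth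
extension past T is maximal, NoTypeII gives
the Type-I rate, and SingularZoom needs only 'no singular element of 𝒦_C', which X gives (an
identically zero field is bounded in every
cylinder) — contradiction, hence the extension and Clay (A). The target SqueezeLiouville and the
four algebra supports are deliberately
not hypotheses of `closes`.

Rationale: WHY THIS LINE. Mechanism (card squeeze-cycle-middle-eigenvalue, audited new-combination): two exact
pieces of 3×3 algebra and a compactness principle.
(i) SIGN LAW: pointwise ω·Sω = 4 det∇u − 4 det S with det∇u = div(u₁∇u₂×∇u₃) a null Lagrangian and
−4 det S = 4λ₂|λ₁||λ₃| signed by the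
MIDDLE strain eigenvalue (Betchov doi:10.1017/S0022112056000317; criteria NeustupaPenel2001,
Miller2019); in backward similarity variables
(ν = 1) the enstrophy Z(s) = ∫|Ω|²dy of a Type-I model obeys ½Z′ + ‖∇Ω‖² + ¼Z = ∫Ω·S_UΩ ≤ (sup Λ⁺)·Z
(|λ₁λ₃| ≤ ½|S|², ∫|S_U|² = ½Z), so a
model with sup Λ < ¼ has a bounded, backward-exponentially-decaying enstrophy and is trivial — 'to
blow up you must squeeze' (MustSqueeze,
threshold 1/8, localised to 𝒦_C). (ii) SHEAR ENDPOINT + BIAXIALITY DEFECT: on sl(3,ℝ), |ω·Sω| ≤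
c₀‖A‖_F‖A²‖_F (c₀ = 1.06603) and
|λ₂(S)| ≤ c₂‖A²‖_F/‖A‖_F (c₂ = 1.0234; both by in-session search, filed with 6/5): near-nilpotent
gradients (flattened layers, A² ≈ 0)
neither produce enstrophy nor are biaxially strained — 'pancakes cannot squeeze themselves', so the
biaxial strain at a production site is
supplied by OTHER vorticity (BuariaPumirBodenschatz2020 self-attenuation;
HamlingtonSchumacherDahm2008 non-local strain). (iii) COMPACTNESS
of 𝒦_C modulo scaling/translation (KNSS2009 Prop 4.1, AlbrittonBarker2019 §2–3, RusinSverak2011)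
makes the supremum of Λ over the class an
ATTAINED maximum (ExtremalElementExists), and the heart becomes a rigidity statement at one extremal
point (ExtremalBiaxialitySubcritical):
there D_sΛ = −Λ² − Λ + ¼(|Ω|² − (Ω·e₂)²) − ∂₂₂P + (viscous ≤ 0) must balance against every
competitor, so the maximal squeeze is paid by the
non-local deviatoric pressure Hessian of other vortex structures, which are themselves sub-maximal —
the card's finite 'who-squeezes-whom'
graph and its k = 1 / 2 / ≥ 3 case analysis (Vieillefosse doi:10.1016/0378-4371(84)90008-6
restricted Euler; MoffattKimura2019; Kida1985,
Pelz2001, BrennerHormozPumir2016 mutual configurations). Imported areas: exact velocity-gradient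
algebra of turbulence phenomenology (Q–R
invariants, restricted Euler), critical-element/compactness rigidity (Kenig–Merle style extremal
object on the Type-I class), and the
Type-I blow-up dictionary (KNSS2009/AlbrittonBarker2019) shared with routes TypeILiouville,
SymmetryModuliCount, ClockStretchingLaw. What it
does that those routes do not: the dichotomy observable is the strain TENSOR's middle eigenvalue
with its signed cubic identity (not a
clock/symmetry mode), it delivers two sharp sl(3) inequalities provable now, and its hard node is an
extremal-point rigidity statement
rather than a bare Liouville claim. Negatives index: 0 refuted statements for this summit (checked
2026-08-15).

RANKED CRUXES. STATUS 2026-08-16 (route-repair): PROVED — MustSqueeze (11610), ExtremalElementExists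
(11611, re-badged support), SingularZoom, NoBlowupToClay, SignLaw, MiddleEigenvalueSign,
ShearEndpoint, BiaxialityDefect, Assembly; OPEN — ExtremalBiaxialitySubcritical (the heart, ⇔ X
unconditionally: Theorems extremalBiaxialitySubcritical_iff_squeezeLiouville, p103437), NoTypeII
(shared), and the heart's recurrent decomposition filed flat (strategist cstrat-11609 + this
repair): SingularProfileOfNontrivial (15368, provable now) → [RecurrentProfiles.RecurrentReduction,
stmt-1590, PROVED] → RecurrentLiouville (1589, shared) → ExtremalBiaxialitySubcritical via the glue
RecurrentBridge (15364, pure logic, kernel-checked). `closes` is unchanged: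
ExtremalBiaxialitySubcritical stays its hypothesis (X suffices), the decomposition is the live way
to reach it. #0 SqueezeLiouville (target) — X — Liouville on the Type-I model class 𝒦_C (class of
route ClockStretchingLaw rev 2, verbatim): for every C, every smooth div-free KNSS-mild ancient
solution on ℝ³×(−∞,0) with |u| ≤ C/√(−t) and scaled energies A, E ≤ C is ≡ 0 on t < 0. Follows from
MustSqueeze, ExtremalElementExists, ExtremalBiaxialitySubcritical by the exhaustive case split 'Λ ≤
1/8 everywhere, or not' (glue `closes`, pure logic); implies NoSingularTypeIModel (stmt-10569) and
is implied by TypeIAncientLiouville (stmt-4050, larger class) and by (L) (stmt-0057). (why it might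
fail: ¬X is one nontrivial Type-I model, e.g. the profile flow of a backward DSS blow-up
(BradshawTsai2017CPDE Open Problem 5.1); open even with one discrete symmetry
(ChaeWolf2017RemovingDSS removes only λ≈1).) [KNSS2009, AlbrittonBarker2019, BradshawTsai2017CPDE,
ChaeWolf2017RemovingDSS]
#2 ExtremalBiaxialitySubcritical (crux) — (card K1–K3 compressed to one typed node: 'no perpetual
squeeze machine') if u ∈ 𝒦_C attains at some (t₀,x₀), t₀ < 0, a Leray-gauge middle strain eigenvalue
Λ_u(t₀,x₀) ≥ m (Courant–Fischer form: the quadratic form of (−t₀)∇u(t₀,x₀) is ≥ m|·|² on an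
orthonormal 2-frame) which is MAXIMAL over the class (every v ∈ 𝒦_C has Λ_v(t,x) ≤ m at every t < 0,
x), then m < 1/8. At such a point every competitor — all rescalings, translates, rotations and
blow-downs of u included — is sub-maximal, so the strain equation gives 0 ≤ −m² − m + ¼(|Ω|² −
(Ω·e₂)²) − ∂₂₂P at (t₀,x₀) in gauge units: the maximal squeeze must be paid by the NON-LOCAL
deviatoric pressure Hessian, i.e. by other vorticity whose own strain sites are sub-maximal
(in-degree ≥ 1 in the card's squeeze graph); intended layer-2 split: k = 1 self-squeeze (killed by
ShearEndpoint/BiaxialityDefect: the producing structure flattens and a flattened structure induces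
no biaxial strain on itself), k = 2 binary (each partner flattens the other), k ≥ 3 polyhedral ⇒
approximately symmetric ⇒ axisymmetric/finite-group Type-I exclusions. [deps: ExtremalElementExists]
[difficulty: open-problem] (why it might fail: A tumbling oblique vortex pair or a backward-DSS
profile would realise an attained gauge biaxiality ≥ 1/8 with MUTUAL (cyclic) squeezing; local
vorticity also pumps λ₂ (restricted-Euler Vieillefosse tail), so optimality at one point may carry
no contradiction.) [doi:10.1016/0378-4371(84)90008-6, doi:10.1063/1.858295,
BuariaPumirBodenschatz2020, MoffattKimura2019, BradshawTsai2017CPDE, Kida1985, Pelz2001]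
#2 RecurrentLiouville (crux; = stmt-NavierStokesRegularity-1589 VERBATIM, SHARED with route
RecurrentProfiles, attached here 2026-08-16) — a suitable weak solution on the slab ℝ³×(−∞,0) with
weak gradient, Albritton–Barker 𝐈 = typeIBound(slab) < ⊤ and rate HasTypeITimeDecay C that is
UNIFORMLY RECURRENT under the NS scaling σ ↦ nsRescale(e^σ) (Birkhoff almost periodic in
L³_loc({t≤0}×ℝ³)) is regular at the origin. It is the whole open difficulty of the recurrent
decomposition (⊇ Bradshaw–Tsai OP 5.1, Type-I λ-DSS Liouville); what recurrence buys: semi-Lyapunov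
functionals are constant on minimal sets, σ-exact spoilers (∂_sP in the head-pressure identity)
average out against invariant measures, Kronecker/weak-mixing dichotomy; SqueezeCycle's proved
floors (nontrivial ⇒ sup Λ > ¼, sup (−t)λ₁ ≥ 1, sup Ky Fan ≥ ½) hold as typed constraints on any
such profile. [difficulty: open-problem] (why it might fail: recurrence gives neither smallness nor
sign; an α≈1 RSS, a large-λ Type-I DSS (e.g. Kida-symmetric) or a weakly-mixing Type-I minimal set
refutes it — PineauVicol2026 Thms 1.4/1.6–1.7 and ChaeWolf2017RemovingDSS Thm 1.3 remove only
extreme rotation and λ≈1.) [PineauVicol2026, ChaeWolf2017RemovingDSS, BradshawTsai2017CPDE,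
Tsai1998, NecasRuzickaSverak1996, SereginSverak2009]
#3 SingularProfileOfNontrivial (crux; stmt-NavierStokesRegularity-15368, provable now) — BRIDGE 𝒦_C
→ Albritton–Barker class (A–B 2019 Thm 1.1, REVERSE direction, run inside 𝒦_C): a member of 𝒦_C not
identically zero on t<0 yields a suitable weak slab solution (w,q,H) with typeIBound(slab) < ⊤, the
SAME rate and a backward-singular ORIGIN — verbatim the hypotheses of RecurrentReduction. Plan:
classical with one pressure (Theorems.exists_isClassicalNSSolutionOn_Iio_of_isTypeIAncientMild) ⇒
suitable on the slab, G = fderiv; A ≤ C ⇒ 𝐈 < ∞ by albrittonBarker2019_lemma_2_6_holds ball-wise,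
class-uniform by the scaling/translation/past-shift invariance of 𝒦_C; blow-down v_k(x,t) =
k·u(x⋆+kx, k²t) at a point of non-vanishing (‖v_k(t⋆/k²,0)‖ = k‖u(t⋆,x⋆)‖ → ∞), engine
slab_typeI_compactness (Theorems/RecurrentProfilesRecurrentReductionOrbit) whose persistence clause
fires; rate a.e. → pointwise by the representative trick of recurrentReduction_proof. [difficulty:
M–L] (why it might fail: true in substance; fails AS STATED only via bookkeeping — slab-wide 𝐈 < ⊤
needs the class-uniform scaled A–B Lemma 2.6 (tree: ball-wise, qualitative) and the KNSS pressure of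
a 𝒦_C member in L^{3/2} on balls touching t = 0 (Morrey bound A ≤ C, not the rate).)
[AlbrittonBarker2019, KNSS2009, Seregin2006, RusinSverak2011, Lin1998, arXiv:1811.00502]
#9 RecurrentBridge (support = the glue of the recurrent decomposition;
stmt-NavierStokesRegularity-15364, provable now, ≈10 lines) — SingularProfileOfNontrivial →
RecurrentLiouville → ExtremalBiaxialitySubcritical: a record configuration (C, m, u, t₀, x₀) has u ≡
0 on t<0 (else Sub₁ gives an origin-singular A–B profile, the PROVED
RecurrentProfiles.RecurrentReduction = stmt-1590 (Theorems.recurrentReduction_proof) a uniformly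
recurrent origin-singular one, which RecurrentLiouville declares regular — absurd), and the
two-frame record inequality for the zero field reads m ≤ 0 < 1/8. Kernel-checked: planner
Sketch.lean (recurrentBridge_holds / recurrentBridge₂_holds / closes_via_recurrent_line, evidence on
15364) = strategist Split.lean. Filed flat because `route edit --split` is final-cycle-only; when
Sub₁, RecurrentLiouville and this glue are proved, `theorem … :
SqueezeCycle.ExtremalBiaxialitySubcritical` is a one-liner. [difficulty: provable-now]
[AlbrittonBarker2019, Furstenberg1981]
#3 MustSqueeze (crux) — ('to blow up you must squeeze'; card (i) + P1 made ancient) an element of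
𝒦_C whose Leray-gauge middle strain eigenvalue satisfies Λ_u(t,x) ≤ 1/8 at every t < 0, x
(Courant–Fischer: the quadratic form of (−t)∇u(t,x) is ≤ (1/8)|·|² on some orthonormal 2-frame)
vanishes identically. Engine: SignLaw + MiddleEigenvalueSign give ω·Sω = 4det∇u − 4det S ≤ 4
div(u₁∇u₂×∇u₃) + 2λ₂⁺|S|²; in similarity variables ½Z′ + ‖∇Ω‖² + ¼Z ≤ (1/8)Z when Z = ∫|Ω|²dy < ∞,
so the bounded Z decays backward-exponentially, Ω ≡ 0, u(t,·) harmonic and bounded ⇒ constant ⇒ 0 by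
the Type-I rate. The item is the LOCALISED statement in 𝒦_C (scaled energies only): the
null-Lagrangian flux ∫u₁(∇u₂×∇u₃)·∇φ and the transport flux through parabolic annuli must be
absorbed by the ¼ − 1/8 margin (Neustupa–Penel-type localisation, doi:10.1007/b137135, in Leray
gauge). [difficulty: L] (why it might fail: In 𝒦_C only scaled local energies are bounded:
similarity enstrophy may be infinite and the cubic and transport fluxes through ∂B_R are of the same
scale-invariant order (∼R) as the ¼-gain, so the Gronwall may close only with spatial Type-I decay
the class does not grant.) [Miller2019, NeustupaPenel2001, doi:10.1007/b137135,
doi:10.1017/S0022112056000317, KNSS2009, Tsai1998]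
#4 ExtremalElementExists (crux) — (compactness of 𝒦_C; replaces the card's P3 'finitely many parts'
by a pointwise extremal principle) if some u ∈ 𝒦_C has a point (t,x), t < 0, where Λ_u(t,x) ≤ 1/8
FAILS (negation of MustSqueeze's hypothesis, verbatim), then there are u′ ∈ 𝒦_C (same C), m ≥ 1/8
and (t₀,x₀), t₀ < 0, with Λ_{u′}(t₀,x₀) ≥ m and Λ_v(t,x) ≤ m for every v ∈ 𝒦_C, t < 0, x. Plan: M*
:= sup Λ over 𝒦_C × (−∞,0) × ℝ³ is finite by the KNSS gradient bound (−t)|∇v| ≤ C₁(C) (Prop 4.1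
bootstrap in the Oseen class); rescale a maximising sequence to (t,x) = (−1,0) (every clause of 𝒦_C
is scaling- and translation-invariant), extract a C^∞_loc(t<0) limit from the uniform C^k bounds,
pass to the limit in the Oseen identity by dominated convergence (kernel bound (14)), in the decay
and scaled-energy clauses pointwise/by Fatou, in Λ by C¹_loc convergence and continuity of
eigenvalues; Courant–Fischer converts λ₂ ≤ m / ≥ m into the typed forms. [difficulty: L] (why it
might fail: Closure of 𝒦_C under local limits needs the Oseen identity to pass to the limit with
only the sup-rate and A, E (no pressure quantity D: AlbrittonBarker2019 Rem 3.2), and sup Λ < ∞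
needs a gradient bound uniform over the class; either gap leaves the sup unattained.) [KNSS2009,
AlbrittonBarker2019, RusinSverak2011, SereginSverak2009, Seregin2014Notes]
#5 NoTypeII (crux) — (shared stmt-NavierStokesRegularity-0056, borrowed not attacked) if a
finite-energy classical solution from a rapidly decaying datum has maximal lifespan T < ∞ then it
blows up at the Type-I rate ‖u(t)‖_∞ ≤ C(T−t)^{−1/2}. [difficulty: open-problem] (why it might fail:
No theorem bounds a blow-up rate from above; Tao's averaged-NS blow-up is Type II (arXiv:1402.0290
p.8 fn.); KNSS2009 p.4: every axisymmetric singularity is Type II, so Hou's candidate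
(arXiv:2107.06509), if real, refutes it (= ¬Clay A).) [Tao2016AveragedNS, arXiv:1402.0290, KNSS2009,
Hou2022PotentiallySingularNS, arXiv:2107.06509, Seregin2012]
#9 SingularZoom (support) — (shared stmt-NavierStokesRegularity-10573 of route ClockStretchingLaw,
verbatim; KNOWN: AlbrittonBarker2019 §3 forward direction + KNSS2009 §6) no singular element in 𝒦_C
⇒ a finite-energy classical solution on [0,T) from a rapidly decaying datum with Type-I rate near T
extends smoothly past T (zoom at a singular point without sup-normalisation, scale-invariant
energies inherited, KNSS smoothing compactness, persistence of singularities RusinSverak2011).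
[difficulty: L] [AlbrittonBarker2019, RusinSverak2011, KNSS2009, SereginSverak2009, CKN1982]
#9 NoBlowupToClay (support) — (shared stmt-NavierStokesRegularity-0055) given no blow-up, build the
Clay (A) solution: local finite-energy classical solution for smooth div-free rapidly decaying data,
continuation, weak–strong uniqueness, bounded energy, conversion by
isNavierStokesSolution_and_smooth_iff. [difficulty: provable-now] [Leray1934, FujitaKato1964,
Fefferman2000]
#9 SignLaw (support) — (card P1, the pointwise identity) for a trace-free real 3×3 matrix A
(velocity gradient, A i j = ∂ⱼuᵢ) with ω = (A₂₁−A₁₂, A₀₂−A₂₀, A₁₀−A₀₁) (= curl u) and S = ½(A + Aᵀ):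
ω·Sω = 4 det A − 4 det S (Cayley–Hamilton tr A³ = 3 det A on sl(3), tr A³ = tr S³ + ¾ ω·Sω; Betchov
1956). Checked numerically to 1e−14 in-session; a `Matrix.det_fin_three` + `ring` exercise.
[difficulty: provable-now] [doi:10.1017/S0022112056000317, Miller2019]
#9 MiddleEigenvalueSign (support) — (card P1, the sign) for trace-free A and S = ½(A + Aᵀ), with μ₀
≥ μ₁ ≥ μ₂ the eigenvalues of A + Aᵀ = 2S (`Matrix.IsHermitian.eigenvalues₀`, antitone): −4 det S = ½
μ₁ |μ₀| |μ₂| — the local part of enstrophy production carries the sign of the MIDDLE eigenvalue (det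
= product of eigenvalues; trace zero forces μ₀ ≥ 0 ≥ μ₂). [difficulty: provable-now] [Miller2019,
NeustupaPenel2001]
#9 ShearEndpoint (support) — (card P2, 'shear endpoint inequality') on sl(3,ℝ): (ω·Sω)² ≤
(36/25)·‖A‖_F²·‖A²‖_F², i.e. |ω·Sω| ≤ (6/5)‖A‖_F‖A²‖_F (sharp constant 1.06603 by in-session random
search + hill-climb, refuter audit 1.06604; equality set of the zero locus: A² = 0, the rank-one
shears a⊗b, a·b = 0, on which ω is the null vector of S). A degree-6 polynomial inequality in 8
variables: SOS certificate / certified numerics, or the tangent-space argument ker(H ↦ NH + HN) =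
T_N{A² = 0} (dim 4) + compactness. [difficulty: M] [doi:10.1016/0378-4371(84)90008-6,
doi:10.1063/1.858295, BuariaPumirBodenschatz2020]
#9 BiaxialityDefect (support) — (new lemma found while typing the route; the algebraic half of card
K1) for trace-free A with μ = eigenvalues of A + Aᵀ (antitone): μ₁²·‖A‖_F² ≤ (144/25)·‖A²‖_F², i.e.
|λ₂(S)| ≤ (6/5)·‖A²‖_F/‖A‖_F (sharp constant 1.0234 by in-session search, stable near the nilpotent
variety): the middle strain eigenvalue is controlled by the NILPOTENCY DEFECT, so a biaxially
strained point (Λ ≥ a) has gauge defect (−t)²‖A²‖_F ≥ (5a/6)(−t)‖A‖_F — near-nilpotent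
(flattened-layer) gradients are never squeeze sites. Same proof technology as ShearEndpoint
(degree-4×2 polynomial inequality via `Matrix.IsHermitian` spectral theorem, or SOS on the
characteristic polynomial). [difficulty: M] [doi:10.1016/0378-4371(84)90008-6,
BuariaPumirBodenschatz2020, Miller2019]

TWO-LAYER PLAN. FILED 2026-08-16 (flat items, since `route edit --split` is final-cycle-only):
ExtremalBiaxialitySubcritical ⇐ SingularProfileOfNontrivial (15368) → [RecurrentReduction =
stmt-1590, PROVED] → RecurrentLiouville (1589, shared) with glue RecurrentBridge (15364) —
strategist cstrat-11609's one switch with teeth (Kenig–Merle/Albritton–Barker transfer: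
nontriviality upgrades to an origin singularity along blow-downs; Birkhoff minimal sets discharge
the non-recurrent case; STRATEGY-CENSUS.md in Cruxes/ExtremalBiaxialitySubcritical/). The
squeeze-graph split foreseen at open — (i) below — is NOT filed and should not be: Disproof gen 3
(Negative/MaximalityFree p72559, Saddle p71639, ExactStrainFlows p71597) shows maximality at a
record is free and no max-point argument can work, and the three direct lines
(quarter-bootstrap-pinning, oseen-shell-polar-tomography, convex-compression-minorant) each
re-partitioned X and died on the cell that is X (leads a, b, a1, a2; crux ⇔ X by
extremalBiaxialitySubcritical_iff_squeezeLiouville p103437). (ii) and (iii) below are moot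
(MustSqueeze and ExtremalElementExists PROVED whole). Original plan, kept for the record: Foreseen
glued splits (none filed now; k ≤ 3, depth 1). (i) ExtremalBiaxialitySubcritical ⇐ NoSelfSqueeze (at
an extremal point the part
of ∂₂₂P induced by the vorticity component containing (t₀,x₀) cannot pay −m² − m:
ShearEndpoint/BiaxialityDefect + flattening under
persistent biaxiality, card K1) → NoBinarySqueeze (two mutually squeezing structures flatten each
other, card K2) → PolyhedralHandover
(k ≥ 3 squeezers force an approximate finite rotation group ⇒ exactly symmetric extremal element ⇒
axisymmetric / finite-group Type-I
exclusions, card K3) → ExtremalBiaxialitySubcritical — filed once the definition request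
SqueezeGraph lands. (ii) MustSqueeze ⇐
QuarterLawFiniteEnstrophy (the ¼-law for models with finite similarity enstrophy, provable now) →
LocalSignedBudget (Leray-gauge
localisation of the signed identity with the null-Lagrangian flux in 𝒦_C) → MustSqueeze. (iii)
ExtremalElementExists ⇐ ClassClosure
(𝒦_C closed under C^∞_loc limits of rescaled translates) → GaugeGradientBound ((−t)|∇u| ≤ C₁(C) on
𝒦_C) → ExtremalElementExists.

KILL CRITERIA. (2026-08-16) RecurrentLiouville refuted — a Kida-symmetric or large-λ Type-I backward
DSS, an α≈1 RSS, or a weakly-mixing Type-I minimal set in the A–B class — is the SAME witness that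
refutes X and ExtremalBiaxialitySubcritical (it lies in some 𝒦_C): close
`refuted:ExtremalBiaxialitySubcritical` together with route RecurrentProfiles.
SingularProfileOfNontrivial refuted as stated (slab-wide 𝐈 bookkeeping) ⇒ misstated: restate
ball-wise (IsSuitableWeakSolutionInBall) through a repaired item, the glue with it. A nontrivial
Type-I model (backward DSS / tumbling-binary ancient solution in 𝒦_C) refutes SqueezeLiouville and
ExtremalBiaxialitySubcritical
at once — close `refuted:ExtremalBiaxialitySubcritical` and hand the witness to the blow-up routes
(it also refutes stmt-4050, stmt-10569's
complement programme and (L′)). MustSqueeze refuted by a Type-I model with infinite similarity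
enstrophy and Λ ≤ 1/8 everywhere ⇒ the
localisation, not the sign law, failed: pivot by restating the class with space–time decay
`HasTypeIDecay` (finite similarity enstrophy)
through a repaired item, and SingularZoom's class with it. ExtremalElementExists refuted (sup not
attained / class not closed) ⇒ restate
𝒦_C with Albritton–Barker's full 𝐈 < ∞ (pressure quantity D). A counterexample MATRIX to
ShearEndpoint or BiaxialityDefect with ratio in
(6/5, ∞) only changes constants (restate); an unbounded ratio would kill mechanism (ii) and with it
the planned split of the heart.
NoTypeII refuted (a Type-II singularity from Schwartz data) kills every positive route.
TypeIAncientLiouville (stmt-4050),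
NoSingularTypeIModel (stmt-10569) or (L) (stmt-0057) proved elsewhere ⇒ close superseded.

NOT DECOMPOSED YET. The squeeze graph itself (parts of a profile at threshold θ, the supplied-strain
functional, in-degree ≥ 1, the k = 1/2/≥3 case analysis)
— deliberately NOT items at open: the card's P3 (uniform finiteness of parts on K_C) is not a lemma
(refuter audit 17-g3), so the heart is
filed as ONE extremal-point statement over accepted declarations and the graph becomes its layer-2
split after the definition request.
Also not decomposed: the flattening-under-persistent-biaxiality estimate (card K1: aspect ratio ≳
e^{2a₀s₀} vs residence time), the
Biot–Savart geometry of binary squeezing (K2), the localisation bookkeeping inside MustSqueeze, the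
compactness package inside
ExtremalElementExists, everything inside NoTypeII (other routes), and the explicit SOS certificates
for the two sl(3) constants.

CHEAPEST FALSIFIER. (a) Ten minutes of algebra/numerics, partly RUN here: random search + hill-climb
over sl(3,ℝ) (scratch/algebra_check*.py, pure python,
2·10⁴ near-nilpotent samples + 400 climbs) gives sup|ω·Sω|/(‖A‖_F‖A²‖_F) = 1.06603 and
sup|λ₂|‖A‖_F/‖A²‖_F = 1.0234, both stable as
A → rank-one shears; the sign law holds to 1e−14. A matrix beating 6/5 restates two supports; an
unbounded sequence kills mechanism (ii).
(b) Symbolic check of the ¼-law bookkeeping (coefficient 1 − 3/4 from Ω + ½y·∇Ω for ν = 1; ∫|S_U|² =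
½∫|Ω|²; |λ₁λ₃| ≤ ½|S|²): a wrong
constant moves the threshold, a wrong SIGN kills MustSqueeze. (c) Lookup (searchd was down; crossref
run): is an ancient/Type-I Liouville
theorem under λ₂ ≤ 0 or small λ₂⁺ already in print (Miller2019 §1, O–Wu 2026 doi:10.1002/mana.70139,
Guo–O 2025
doi:10.1016/j.aml.2024.109354, NP 2005)? If yes, MustSqueeze is `known` in the finite-enstrophy
class and only its 𝒦_C localisation remains.
(d) The tumbling oblique binary as a periodic orbit of the Leray-rescaled flow in a symmetry class
(numerics, MoffattKimura2019 set-up)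
would refute ExtremalBiaxialitySubcritical outright.

NUMBERS. Thresholds: ¼ = 1 − ¾ (gauge scaling gain of the enstrophy in backward similarity
variables, ν = 1); dichotomy threshold 1/8 (any a₀ ∈ (0,¼)
works; margin ¼ − 1/8 = 1/8 is what MustSqueeze's localisation may spend). Algebra: |λ₁λ₃| ≤ ½|S|²;
∫|S|² = ½∫|ω|² (div-free, decaying);
c₀ = sup|ω·Sω|/(‖A‖_F‖A²‖_F) = 1.06603 (filed 6/5, squared 36/25); c₂ = sup|λ₂|‖A‖_F/‖A²‖_F = 1.0234
(filed 6/5, i.e. μ₁²‖A‖² ≤ (144/25)‖A²‖²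
for μ = spec(A + Aᵀ)). Known Liouville cases consistent with MustSqueeze: 2-D (λ₂ ≡ 0; KNSS2009 Thm
5.1), parallel shear flows (A² = 0,
λ₂ = 0). Items at open: 12 (4 cruxes incl. 1 shared, 6 supports incl. 2 shared, target, assembly);
`closes` has 6 hypotheses.

DEFINITION REQUESTS. None blocking (every item inlines accepted declarations: heatFlow,
UnboundedOperators.heatKernel, HasTypeITimeDecay, VectorCalculus.IsDivFree,
fderiv, Matrix.det/trace, Matrix.IsHermitian.eigenvalues₀, IsClassicalNSSolutionOn, IsLerayHopfOn,
HasRapidSpatialDecay, IsTypeIBlowup,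
HasSmoothExtensionPast, IsMaximalSmoothSolution). To be filed after open for layer 2 (topic
Summits/NavierStokesRegularity/NavierStokesRegularity/Theorems):
`LerayGaugeStrainSpectrum` (Λ_u(t,x) and the gauge nilpotency defect (−t)²‖∇u²‖/((−t)‖∇u‖) as
functions, with the Courant–Fischer
lemmas linking them to the inline forms) and `SqueezeGraph` (parts of a Type-I model at threshold θ,
the supplied-strain functional via the
Biot–Savart law, the directed graph and its cycles).

Novelty: Searches (2026-08-15; searchd/local index rc 75 all session, OpenAlex 429; crossref + galaxy
worked): `lit search --source crossref "middle
eigenvalue strain Navier-Stokes regularity"` (10: Miller2019 doi:10.1007/s00205-019-01419-z +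
addendum doi:10.1007/s00205-020-01527-1, Wu 2021
doi:10.3934/eect.2020078, doi:10.1063/5.0043459, Guo–O 2025 doi:10.1016/j.aml.2024.109354, O–Wu 2026
doi:10.1002/mana.70139 — ALL L^p_tL^q_x
regularity/extension/blow-up CRITERIA, none Liouville/ancient/Type-I); `… "Liouville theorem ancient
solutions Navier-Stokes strain eigenvalue
Type I"` (8: steady Liouville only — Seregin 2016, ChaeWolf2019, Chae 2025); `… "vortex stretching
bound nilpotent velocity gradient restricted
Euler shear layer depletion"` (8: Cantwell 1992, HouLi2006 depletion numerics; no inequality of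
ShearEndpoint/BiaxialityDefect type); `…
"self-attenuation extreme events … non-local strain"` (8: BuariaPumirBodenschatz2020, Miller strain
model doi:10.2140/apde.2023.16.997, NP 2008);
`… "critical element minimal blow-up … Type I ancient"` (8, noise); `lit galaxy search "middle
eigenvalue of the strain" --star all` (3: Lemarié-Rieusset
book, Ting–Klein–Knio book, Miller arXiv:2007.02023); `lit galaxy search "bounded ancient solution"
--star pdf` (0); `lit frontier
NavierStokesRegularity --since 2024` (30 rows: forward self-similar, non-uniqueness, Hou-type
numerics — nothing on strain-eigenvalue
geometry); grep of all 57 Theses files of the sub for middle-eigenvalue/squeeze/Betchov  [refs: 10.1007/s00205-019-01419-z, 10.1007/s00205-020-01527-1, 10.3934/eect.2020078, 10.1063/5.0043459, 10.1016/j.aml.2024.109354, 10.1002/mana.70139, 10.2140/apde.2023.16.997, 10.1007/b137135:, 2007.02023, doi:10.1007/s00205-019-01419-z, doi:10.1007/s00205-020-01527-1, doi:10.3934/eect.2020078, doi:10.1063/5.0043459, doi:10.1016/j.aml.2024.109354, doi:10.1002/mana.70139, doi:10.2140/apde.2023.16.997, do]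

Barriers (technique_class: signed-cubic-identity, strain-geometry, liouville-rigidity): - technique_class: signed-cubic-identity, strain-geometry, liouville-rigidity
- Literature.Barriers.NavierStokesRegularity.TaoAveragedBlowup: evaded by the deciding items —
MustSqueeze and ExtremalBiaxialitySubcritical run on the EXACT pointwise cubic algebra of (ω·∇)u
(det∇u a null Lagrangian, det S eigenvalue-signed, ShearEndpoint/BiaxialityDefect on sl(3)),
identities that are false for averaged/rotated-dilated bilinear forms; Tao's witness is Type II
(outside 𝒦_C); NoTypeII is borrowed and openly not evaded.
- Literature.Barriers.NavierStokesRegularity.TruncatedDyadicBlowup: same answer — no dyadic/averaged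
model keeps the signed determinant structure; not engaged by the Liouville half, not evaded by
NoTypeII.
- Literature.Barriers.NavierStokesRegularity.EnergySupercriticality: not engaged coercively — every
item is scale-invariant (Leray gauge) and the ¼ is a scaling gain, not an energy bound; conceded:
MustSqueeze's localisation in 𝒦_C reintroduces flux-vs-bulk bookkeeping exactly at critical scaling
— the bet is the signed structure (margin ¼ − 1/8), not coercivity; NoTypeII does not evade it.
- Literature.Barriers.NavierStokesRegularity.NavierStokesInequalitySingularSolution: evaded —
everything runs on the vorticity equation and the exact pressure-free cubic algebra of the velocity
gradient, unavailable for the Navier–Stokes inequality (Scheffer-type solutions have no vorticity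
equation).
- Literature.Barriers.NavierStokesRegularity.LeraySelfSimilarBlowupExclusion: c

History (route lifecycle, newest last):
- 2026-08-15T22:52:30Z · rev 2: restated Assembly (stmt-NavierStokesRegularity-11616 proved) — route-repair (glue-native-fail): `closes` UNCHANGED (6 hyps MustSqueeze/ExtremalElementExists/ExtremalBiaxialitySubcritical/SingularZoom/NoTypeII/NoBlowupToClay (planner-rglue-NavierStokesRegularity-SqueezeC-8984262a-0)
- 2026-09-04T10:54:11Z · DORMANT — reconciler: no traction for 5 d (last activity statement-claimed at 2026-08-30T10:20:50Z); parked, not closed — `ledger route dormant route-NavierStokesRegulari (operator:999:3981035)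

sub-problem: NavierStokesRegularity · status: dormant · opened planner-plancard-NavierStokesRegularity-Navie-45573ef3-0 2026-08-15T18:27:35Z · rev 10 · ledger route-NavierStokesRegularity-SqueezeCycle
GENERATED by the gate from the ledger (D-0016/17). Provers cite these decls: `theorem foo : Summit.NavierStokesRegularity.NavierStokesRegularity.Theses.SqueezeCycle.<Decl> := …` in Summits/NavierStokesRegularity/NavierStokesRegularity/Theorems/<Name>.lean.
-/

namespace Summit.NavierStokesRegularity.NavierStokesRegularity.Theses.SqueezeCycle

open scoped BigOperators Topology Manifold Classical MeasureTheory ProbabilityTheory Matrix InnerProductSpace ComplexConjugate ContinuousMap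
open Filter Set Function TopologicalSpace MeasureTheory

attribute [summit_statement] _root_.NavierStokesRegularity

open Literature.NS

/-- item stmt-NavierStokesRegularity-11608 · target · rank 0 · open · by planner
why it might fail: ¬X is ONE nontrivial Type-I model in 𝒦_C, e.g. the profile flow of a backward λ-DSS/RDSS blow-up (Bradshaw–Tsai 2017 Open Problem 5.1 = decl TypeIDSSLiouvilleConjecture, open; Chae–Wolf 2017 removes only λ near 1); conjecture (L) of Seregin–Šverák is open outside the axisymmetric class.
sources: KNSS2009, SereginSverak2009, AlbrittonBarker2019, BradshawTsai2017CPDE, Tsai2018, ChaeWolf2017RemovingDSS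
[target] X — Liouville on the Type-I model class 𝒦_C (class of route ClockStretchingLaw rev 2,
verbatim): for every C, every smooth div-free KNSS-mild ancient solution on ℝ³×(−∞,0) with |u| ≤
C/√(−t) and scaled energies A, E ≤ C is ≡ 0 on t < 0. Follows from MustSqueeze,
ExtremalElementExists, ExtremalBiaxialitySubcritical by the exhaustive case split 'Λ ≤ 1/8
everywhere, or not' (glue `closes`, pure logic); implies NoSingularTypeIModel (stmt-10569) and is
implied by TypeIAncientLiouville (stmt-4050, larger class) and by (L) (stmt-0057). -/
@[route_item "route-NavierStokesRegularity-SqueezeCycle"]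
def SqueezeLiouville : Prop :=
  ∀ (C : ℝ) (u : ℝ → EuclideanSpace ℝ (Fin 3) → EuclideanSpace ℝ (Fin 3)), ContDiffOn ℝ (⊤ : ℕ∞) (Function.uncurry u) (Set.Iio 0 ×ˢ Set.univ) ∧ (∀ t < 0, Literature.Analysis.FluidPDE.VectorCalculus.IsDivFree (u t)) ∧ (∀ s t : ℝ, s < t → t < 0 → ∀ x, u t x = Literature.Analysis.FluidPDE.heatFlow (u s) (t-s) x - ∫ τ in Set.Ioo s t, ∫ y, ((-(inner ℝ (x-y) (u τ y) / (2*(t-τ)) * Literature.Analysis.UnboundedOperators.heatKernel (t-τ) (x-y))) • u τ y + (∫ σ in Set.Ioi (t-τ), Literature.Analysis.UnboundedOperators.heatKernel σ (x-y) / (4*σ^2)) • (inner ℝ (x-y) (u τ y) • u τ y + inner ℝ (u τ y) (u τ y) • (x-y) + inner ℝ (x-y) (u τ y) • u τ y) - ((∫ σ in Set.Ioi (t-τ), Literature.Analysis.UnboundedOperators.heatKernel σ (x-y) / (8*σ^3)) * (inner ℝ (x-y) (u τ y) * inner ℝ (x-y) (u τ y))) • (x-y))) ∧ Literature.Analysis.FluidPDE.HasTypeITimeDecay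 C u ∧ (∀ (x₀ : EuclideanSpace ℝ (Fin 3)) (t₀ r : ℝ), t₀ ≤ 0 → 0 < r → (∀ t, t₀ - r^2 < t → t < t₀ → r⁻¹ * ∫ x in Metric.ball x₀ r, ‖u t x‖^2 ≤ C) ∧ r⁻¹ * ∫ t in Set.Ioo (t₀ - r^2) t₀, ∫ x in Metric.ball x₀ r, ‖fderiv ℝ (u t) x‖^2 ≤ C) → ∀ t < 0, ∀ x, u t x = 0

/-- item stmt-NavierStokesRegularity-11609 · crux · rank 2 · open · by planner
why it might fail: At an attained maximum m ≥ 1/8 the strain equation only gives m²+m ≤ ¼(|Ω|²−(Ω·e₂)²) − ∂₂₂P + visc.: the non-local pressure Hessian of OTHER vorticity can pay it (cyclic squeezing: a tumbling oblique pair or a backward-DSS profile, Bradshaw–Tsai OP 5.1), so pointwise optimality may force nothing.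
sources: doi:10.1016/0378-4371(84)90008-6, doi:10.1063/1.858295, HamlingtonSchumacherDahm2008, BuariaPumirBodenschatz2020, MoffattKimura2019, BradshawTsai2017CPDE
[crux] (card K1–K3 compressed to one typed node: 'no perpetual squeeze machine') if u ∈ 𝒦_C attains
at some (t₀,x₀), t₀ < 0, a Leray-gauge middle strain eigenvalue Λ_u(t₀,x₀) ≥ m (Courant–Fischer
form: the quadratic form of (−t₀)∇u(t₀,x₀) is ≥ m|·|² on an orthonormal 2-frame) which is MAXIMAL
over the class (every v ∈ 𝒦_C has Λ_v(t,x) ≤ m at every t < 0, x), then m < 1/8. At such a point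
every competitor — all rescalings, translates, rotations and blow-downs of u included — is
sub-maximal, so the strain equation gives 0 ≤ −m² − m + ¼(|Ω|² − (Ω·e₂)²) − ∂₂₂P at (t₀,x₀) in gauge
units: the maximal squeeze must be paid by the NON-LOCAL deviatoric pressure Hessian, i.e. by other
vorticity whose own strain sites are sub-maximal (in-degree ≥ 1 in the card's squeeze graph);
intended layer-2 split: k = 1 self-squeeze (killed by ShearEndpoint/BiaxialityDefect: the producing
structure flattens and a flattened structure induces no biaxial strain on itself), k = 2 binary
(each partner flattens the other), k ≥ 3 polyhedral ⇒ approximately symmetric ⇒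
axisymmetric/finite-group Type-I exclusions. [deps: ExtremalElementExists] [difficulty:
open-problem] -/
@[route_item "route-NavierStokesRegularity-SqueezeCycle"]
def ExtremalBiaxialitySubcritical : Prop :=
  ∀ (C m : ℝ) (u : ℝ → EuclideanSpace ℝ (Fin 3) → EuclideanSpace ℝ (Fin 3)) (t₀ : ℝ) (x₀ : EuclideanSpace ℝ (Fin 3)), t₀ < 0 → (ContDiffOn ℝ (⊤ : ℕ∞) (Function.uncurry u) (Set.Iio 0 ×ˢ Set.univ) ∧ (∀ t < 0, Literature.Analysis.FluidPDE.VectorCalculus.IsDivFree (u t)) ∧ (∀ s t : ℝ, s < t → t < 0 → ∀ x, u t x = Literature.Analysis.FluidPDE.heatFlow (u s) (t-s) x - ∫ τ in Set.Ioo s t, ∫ y, ((-(inner ℝ (x-y) (u τ y) / (2*(t-τ)) * Literature.Analysis.UnboundedOperators.heatKernel (t-τ) (x-y))) • u τ y + (∫ σ in Set.Ioi (t-τ), Literature.Analysis.UnboundedOperators.heatKernel σ (x-y) / (4*σ^2)) • (inner ℝ (x-y) (u τ y) • u τ y + inner ℝ (u τ y) (u τ y) • (x-y) + inner ℝ (x-y)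 (u τ y) • u τ y) - ((∫ σ in Set.Ioi (t-τ), Literature.Analysis.UnboundedOperators.heatKernel σ (x-y) / (8*σ^3)) * (inner ℝ (x-y) (u τ y) * inner ℝ (x-y) (u τ y))) • (x-y))) ∧ Literature.Analysis.FluidPDE.HasTypeITimeDecay C u ∧ (∀ (x₀ : EuclideanSpace ℝ (Fin 3)) (t₀ r : ℝ), t₀ ≤ 0 → 0 < r → (∀ t, t₀ - r^2 < t → t < t₀ → r⁻¹ * ∫ x in Metric.ball x₀ r, ‖u t x‖^2 ≤ C) ∧ r⁻¹ * ∫ t in Set.Ioo (t₀ - r^2) t₀, ∫ x in Metric.ball x₀ r, ‖fderiv ℝ (u t) x‖^2 ≤ C)) → (∃ v w : EuclideanSpace ℝ (Fin 3), ‖v‖ = 1 ∧ ‖w‖ = 1 ∧ inner ℝ v w = 0 ∧ ∀ α β : ℝ, m * (α^2 + β^2) ≤ (-t₀) * inner ℝ (fderiv ℝ (u t₀) x₀ (α • v + β • w)) (α • v + β • w)) → (∀ v' : ℝ → EuclideanSpace ℝ (Fin 3) → EuclideanSpace ℝ (Fin 3), ContDiffOn ℝ (⊤ : ℕ∞) (Function.uncurry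 v') (Set.Iio 0 ×ˢ Set.univ) ∧ (∀ t < 0, Literature.Analysis.FluidPDE.VectorCalculus.IsDivFree (v' t)) ∧ (∀ s t : ℝ, s < t → t < 0 → ∀ x, v' t x = Literature.Analysis.FluidPDE.heatFlow (v' s) (t-s) x - ∫ τ in Set.Ioo s t, ∫ y, ((-(inner ℝ (x-y) (v' τ y) / (2*(t-τ)) * Literature.Analysis.UnboundedOperators.heatKernel (t-τ) (x-y))) • v' τ y + (∫ σ in Set.Ioi (t-τ), Literature.Analysis.UnboundedOperators.heatKernel σ (x-y) / (4*σ^2)) • (inner ℝ (x-y) (v' τ y) • v' τ y + inner ℝ (v' τ y) (v' τ y) • (x-y) + inner ℝ (x-y) (v' τ y) • v' τ y) - ((∫ σ in Set.Ioi (t-τ), Literature.Analysis.UnboundedOperators.heatKernel σ (x-y) / (8*σ^3)) * (inner ℝ (x-y) (v' τ y) * inner ℝ (x-y) (v' τ y))) • (x-y))) ∧ Literature.Analysis.FluidPDE.HasTypeITimeDecay C v' ∧ (∀ (x₀ : EuclideanSpace ℝ (Fin 3)) (t₀ r : ℝ), t₀ ≤ 0 → 0 < r → (∀ t, t₀ -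 r^2 < t → t < t₀ → r⁻¹ * ∫ x in Metric.ball x₀ r, ‖v' t x‖^2 ≤ C) ∧ r⁻¹ * ∫ t in Set.Ioo (t₀ - r^2) t₀, ∫ x in Metric.ball x₀ r, ‖fderiv ℝ (v' t) x‖^2 ≤ C) → ∀ t < 0, ∀ x, (∃ v w : EuclideanSpace ℝ (Fin 3), ‖v‖ = 1 ∧ ‖w‖ = 1 ∧ inner ℝ v w = 0 ∧ ∀ α β : ℝ, (-t) * inner ℝ (fderiv ℝ (v' t) x (α • v + β • w)) (α • v + β • w) ≤ m * (α^2 + β^2))) → m < 1 / 8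

/-- item stmt-NavierStokesRegularity-11716 · crux · rank 2 · open · by planner
why it might fail: ¬X is ONE apex-class Type-I profile: a large-λ backward DSS (Bradshaw–Tsai 2017 OP 5.1; Chae–Wolf 2017 removes only λ≈1), a finite-symmetry DSS, an α≈1 RSS (Pineau–Vicol 2026 removes only extreme rotation) or an aperiodic minimal hull; nothing in print excludes them.
sources: KNSS2009, AlbrittonBarker2019, Tsai1998, ChaeWolf2017RemovingDSS, BradshawTsai2017CPDE, PineauVicol2026
[target] X — no suitable weak solution on ℝ³×(−∞,0) with 𝐈 < ∞ and |u(x,t)| ≤ C/(|x|+√−t) has a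
(backward) singular point at the origin; the KNSS (1.6) form of "no Type-I blow-up profile", implied
by the Liouville conjecture (L) and by RecurrentProfiles' target stmt-1588 (rate class ⊇ apex
class). -/
@[route_item "route-NavierStokesRegularity-SqueezeCycle"]
def NoApexTypeIProfile : Prop :=
  ∀ (u : ℝ → EuclideanSpace ℝ (Fin 3) → EuclideanSpace ℝ (Fin 3)) (p : ℝ → EuclideanSpace ℝ (Fin 3) → ℝ) (G : ℝ → EuclideanSpace ℝ (Fin 3) → EuclideanSpace ℝ (Fin 3) →L[ℝ] EuclideanSpace ℝ (Fin 3)) (C : ℝ), Literature.Analysis.FluidPDE.IsSuitableWeakSolutionOn (Literature.Analysis.FluidPDE.slab (EuclideanSpace ℝ (Fin 3)) (Set.Iio 0) isOpen_Iio) 1 0 u p → Literature.Analysis.FluidPDE.HasWeakSpatialGradientOn (Literature.Analysis.FluidPDE.slab (EuclideanSpace ℝ (Fin 3)) (Set.Iio 0) isOpen_Iio) u G → Literature.Analysis.FluidPDE.typeIBound (Set.Iio (0 : ℝ) ×ˢ Set.univ) u p G < ⊤ → Literature.Analysis.FluidPDE.HasTypeIDecay C u → ¬ Literature.Analysis.FluidPDE.IsBackwardSingularPoint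 u 0

/-- item stmt-NavierStokesRegularity-1589 · crux · rank 2 · open · by planner
why it might fail: Recurrence gives neither smallness nor sign; periodic rungs open beyond SS, extreme-α RSS (PineauVicol2026 Thm 1.4) and λ≈1 (ChaeWolf2017RemovingDSS Thm 1.3; PineauVicol2026 Thms 1.6–1.7): an α≈1 RSS, a large-λ Type-I DSS or a weakly-mixing Type-I minimal set refutes it.
sources: PineauVicol2026, ChaeWolf2017RemovingDSS, BradshawTsai2017CPDE, Tsai2018, Tsai1998, NecasRuzickaSverak1996
[crux] RECURRENT LIOUVILLE THEOREM (card X2). Class: u suitable weak (ν=1) on the slab ℝ³×(−∞,0)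
with pressure p and weak gradient G, typeIBound(slab) u p G < ⊤ (A–B 𝐈<∞; kills the parasitic drifts
b(t) admitted by the duality-form mild class), rate HasTypeITimeDecay C u. Hypothesis: u is
UNIFORMLY RECURRENT (Birkhoff almost periodic) for the scaling flow σ ↦ nsRescale(e^σ)u in
L³_loc(ℝ³×(−∞,0]): ∀ε ∀K compact ⊆ {t≤0} ∃L ∀a ∃σ∈[a,a+L]: ‖u_σ − u‖_{L³(K)} ≤ ε. Conclusion: (0,0)
is not a backward singular point — equivalent to u = 0 a.e. (support RecurrentRegularIsTrivial).
Known rungs: fixed points = backward self-similar (NecasRuzickaSverak1996 Thm 1, Tsai1998 Thms 1–2: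
none); periodic orbits = λ-DSS: open = TypeIDSSLiouvilleConjecture except λ∈(1,λ_*(C)) and small C
(ChaeWolf2017RemovingDSS Thm 1.3, Rmk 1.4); axisymmetric: true (SereginSverak2009). New regimes:
quasi-periodic and weakly-mixing minimal sets. Tools recurrence buys: (a) a functional continuous on
the orbit closure and non-increasing along the flow is CONSTANT on a minimal set (semi-Lyapunov
rigidity, no coercivity: e.g. suprema of the head pressure Π=|U|²/2+P+a y·U, NRS1996 Lemma 3.3, tree
IsLerayProfile.driftOp_headP -/
@[route_item "route-NavierStokesRegularity-SqueezeCycle"]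
def RecurrentLiouville : Prop :=
  ∀ (u : ℝ → EuclideanSpace ℝ (Fin 3) → EuclideanSpace ℝ (Fin 3)) (p : ℝ → EuclideanSpace ℝ (Fin 3) → ℝ) (G : ℝ → EuclideanSpace ℝ (Fin 3) → EuclideanSpace ℝ (Fin 3) →L[ℝ] EuclideanSpace ℝ (Fin 3)) (C : ℝ), Literature.Analysis.FluidPDE.IsSuitableWeakSolutionOn (Literature.Analysis.FluidPDE.slab (EuclideanSpace ℝ (Fin 3)) (Set.Iio 0) isOpen_Iio) 1 0 u p → Literature.Analysis.FluidPDE.HasWeakSpatialGradientOn (Literature.Analysis.FluidPDE.slab (EuclideanSpace ℝ (Fin 3)) (Set.Iio 0) isOpen_Iio) u G → Literature.Analysis.FluidPDE.typeIBound (Set.Iio (0 : ℝ) ×ˢ Set.univ) u p G < ⊤ → Literature.Analysis.FluidPDE.HasTypeITimeDecay C u → (∀ ε : ℝ, 0 < ε → ∀ K : Set (ℝ × EuclideanSpace ℝ (Fin 3)), IsCompact K → K ⊆ Set.Iic (0 : ℝ) ×ˢ Set.univ → ∃ L : ℝ, 0 < L ∧ ∀ a : ℝ, ∃ σ ∈ Set.Icc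 a (a + L), MeasureTheory.eLpNorm (fun z : ℝ × EuclideanSpace ℝ (Fin 3) => Literature.Analysis.FluidPDE.nsRescale (Real.exp σ) u z.1 z.2 - u z.1 z.2) 3 (MeasureTheory.volume.restrict K) ≤ ENNReal.ofReal ε) → ¬ Literature.Analysis.FluidPDE.IsBackwardSingularPoint u 0

/-- item stmt-NavierStokesRegularity-11610 · crux · rank 3 · closed · proved by Summit.NavierStokesRegularity.NavierStokesRegularity.Theorems.squeezeCycle_mustSqueeze_proof (prover) · by planner
why it might fail: Engine (Miller's λ₂⁺ enstrophy law in Leray variables, ½Z′+‖∇Ω‖²+¼Z ≤ supΛ⁺·Z) needs Z=∫|Ω|²dy<∞; 𝒦_C grants only |Ω| ≤ C₁(C) and scaled LOCAL energies, so cut-off fluxes (cubic null-Lagrangian, y·∇ and U·∇ transport, ∼R) compete with the 1/8 margin; false iff a Type-I ancient u has Λ≤1/8 (open).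
sources: Miller2019, doi:10.1007/s00205-020-01527-1, NeustupaPenel2001, doi:10.1007/b137135, KNSS2009, SereginSverak2009
[crux] ('to blow up you must squeeze'; card (i) + P1 made ancient) an element of 𝒦_C whose
Leray-gauge middle strain eigenvalue satisfies Λ_u(t,x) ≤ 1/8 at every t < 0, x (Courant–Fischer:
the quadratic form of (−t)∇u(t,x) is ≤ (1/8)|·|² on some orthonormal 2-frame) vanishes identically.
Engine: SignLaw + MiddleEigenvalueSign give ω·Sω = 4det∇u − 4det S ≤ 4 div(u₁∇u₂×∇u₃) + 2λ₂⁺|S|²; in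
similarity variables ½Z′ + ‖∇Ω‖² + ¼Z ≤ (1/8)Z when Z = ∫|Ω|²dy < ∞, so the bounded Z decays
backward-exponentially, Ω ≡ 0, u(t,·) harmonic and bounded ⇒ constant ⇒ 0 by the Type-I rate. The
item is the LOCALISED statement in 𝒦_C (scaled energies only): the null-Lagrangian flux
∫u₁(∇u₂×∇u₃)·∇φ and the transport flux through parabolic annuli must be absorbed by the ¼ − 1/8
margin (Neustupa–Penel-type localisation, doi:10.1007/b137135, in Leray gauge). [difficulty: L] -/
@[route_item "route-NavierStokesRegularity-SqueezeCycle"]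
def MustSqueeze : Prop :=
  ∀ (C : ℝ) (u : ℝ → EuclideanSpace ℝ (Fin 3) → EuclideanSpace ℝ (Fin 3)), ContDiffOn ℝ (⊤ : ℕ∞) (Function.uncurry u) (Set.Iio 0 ×ˢ Set.univ) ∧ (∀ t < 0, Literature.Analysis.FluidPDE.VectorCalculus.IsDivFree (u t)) ∧ (∀ s t : ℝ, s < t → t < 0 → ∀ x, u t x = Literature.Analysis.FluidPDE.heatFlow (u s) (t-s) x - ∫ τ in Set.Ioo s t, ∫ y, ((-(inner ℝ (x-y) (u τ y) / (2*(t-τ)) * Literature.Analysis.UnboundedOperators.heatKernel (t-τ) (x-y))) • u τ y + (∫ σ in Set.Ioi (t-τ), Literature.Analysis.UnboundedOperators.heatKernel σ (x-y) / (4*σ^2)) • (inner ℝ (x-y) (u τ y) • u τ y + inner ℝ (u τ y) (u τ y) • (x-y) + inner ℝ (x-y) (u τ y) • u τ y) - ((∫ σ in Set.Ioi (t-τ), Literature.Analysis.UnboundedOperators.heatKernel σ (x-y) / (8*σ^3)) * (inner ℝ (x-y) (u τ y) * inner ℝ (x-y) (u τ y))) • (x-y))) ∧ Literature.Analysis.FluidPDE.HasTypeITimeDecay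 C u ∧ (∀ (x₀ : EuclideanSpace ℝ (Fin 3)) (t₀ r : ℝ), t₀ ≤ 0 → 0 < r → (∀ t, t₀ - r^2 < t → t < t₀ → r⁻¹ * ∫ x in Metric.ball x₀ r, ‖u t x‖^2 ≤ C) ∧ r⁻¹ * ∫ t in Set.Ioo (t₀ - r^2) t₀, ∫ x in Metric.ball x₀ r, ‖fderiv ℝ (u t) x‖^2 ≤ C) → (∀ t < 0, ∀ x, (∃ v w : EuclideanSpace ℝ (Fin 3), ‖v‖ = 1 ∧ ‖w‖ = 1 ∧ inner ℝ v w = 0 ∧ ∀ α β : ℝ, (-t) * inner ℝ (fderiv ℝ (u t) x (α • v + β • w)) (α • v + β • w) ≤ (1 / 8 : ℝ) * (α^2 + β^2))) → ∀ t < 0, ∀ x, u t x = 0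

-- `MustSqueeze` holds: proved by `Summit.NavierStokesRegularity.NavierStokesRegularity.Theorems.squeezeCycle_mustSqueeze_proof` (its module imports this route file, so no `_holds` link can be stated here).

/-- item stmt-NavierStokesRegularity-11719 · crux · rank 3 · open · by planner
why it might fail: Isolating final-time singular points needs L^∞_t L^{3,∞}_x (Choe–Wolf–Yang 2019; Barker arXiv:2111.14776), which rate + 𝐈<⊤ do not give; a rate profile with a scaling-recurrent Cantor-dust final-time singular set may have no apex profile in its orbit closure; 5 selection lines died.
sources: doi:10.1007/s00208-019-01843-2, arXiv:2111.14776, arXiv:1901.08842, CaffarelliKohnNirenberg1982, AlbrittonBarker2019, KNSS2009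
[crux] APEX LOCALISATION: if a suitable weak solution on the slab with 𝐈 < ∞ and the Type-I RATE |u|
≤ C/√−t is singular at the origin (the class produced by TypeIBlowupProfile, stmt-1591), then some
suitable weak solution on the slab with 𝐈 < ∞ and the SPACE–TIME bound |u| ≤ C'/(|x|+√−t) is
singular at the origin — among the translates / zooms / limits of a rate-Type-I singular profile
there is one whose final-time singular set is scale-invariantly isolated (equivalently: no flow in
its scaling-orbit closure is singular on S²×{0}). [difficulty: L] -/
@[route_item "route-NavierStokesRegularity-SqueezeCycle"]
def ApexLocalisation : Prop :=
  ∀ C : ℝ, (∃ (u : ℝ → EuclideanSpace ℝ (Fin 3) → EuclideanSpace ℝ (Fin 3)) (p : ℝ → EuclideanSpace ℝ (Fin 3) → ℝ) (G : ℝ → EuclideanSpace ℝ (Fin 3) → EuclideanSpace ℝ (Fin 3) →L[ℝ] EuclideanSpace ℝ (Fin 3)), Literature.Analysis.FluidPDE.IsSuitableWeakSolutionOn (Literature.Analysis.FluidPDE.slab (EuclideanSpace ℝ (Fin 3)) (Set.Iio 0) isOpen_Iio) 1 0 u p ∧ Literature.Analysis.FluidPDE.HasWeakSpatialGradientOn (Literature.Analysis.FluidPDE.slab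 (EuclideanSpace ℝ (Fin 3)) (Set.Iio 0) isOpen_Iio) u G ∧ Literature.Analysis.FluidPDE.typeIBound (Set.Iio (0 : ℝ) ×ˢ Set.univ) u p G < ⊤ ∧ Literature.Analysis.FluidPDE.HasTypeITimeDecay C u ∧ Literature.Analysis.FluidPDE.IsBackwardSingularPoint u 0) → ∃ (C' : ℝ) (u : ℝ → EuclideanSpace ℝ (Fin 3) → EuclideanSpace ℝ (Fin 3)) (p : ℝ → EuclideanSpace ℝ (Fin 3) → ℝ) (G : ℝ → EuclideanSpace ℝ (Fin 3) → EuclideanSpace ℝ (Fin 3) →L[ℝ] EuclideanSpace ℝ (Fin 3)), Literature.Analysis.FluidPDE.IsSuitableWeakSolutionOn (Literature.Analysis.FluidPDE.slab (EuclideanSpace ℝ (Fin 3)) (Set.Iio 0) isOpen_Iio) 1 0 u p ∧ Literature.Analysis.FluidPDE.HasWeakSpatialGradientOn (Literature.Analysis.FluidPDE.slab (EuclideanSpace ℝ (Fin 3)) (Set.Iio 0) isOpen_Iio) u G ∧ Literature.Analysis.FluidPDE.typeIBound (Set.Iio (0 : ℝ) ×ˢ Set.univ) u p G < ⊤ ∧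 Literature.Analysis.FluidPDE.HasTypeIDecay C' u ∧ Literature.Analysis.FluidPDE.IsBackwardSingularPoint u 0

/-- item stmt-NavierStokesRegularity-0056 · crux · rank 5 · open · by planner
why it might fail: No theorem bounds a blow-up rate from above; Tao's averaged-NS blow-up is Type II (arXiv:1402.0290 p.8 fn.); KNSS2009/Seregin–Šverák 2009: an axisymmetric singularity must be Type II, so Hou's axisymmetric candidate (arXiv:2107.06509), if real, refutes it (= ¬Clay A).
sources: Tao2016AveragedNS, arXiv:1402.0290, KNSS2009, SereginSverak2009, Hou2022PotentiallySingularNS, arXiv:2107.06509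
If a finite-energy classical solution from a rapidly decaying datum has maximal lifespan T<∞ (no
classical extension past T), then ‖u(t)‖_∞ ≤ C (T−t)^{-1/2} eventually as t↑T (Leray's rate is the
matching lower bound, leray_blowup_rate_top). The hardest and most informative crux: a
counterexample is a Type II singularity, i.e. ¬(Clay A). Known: lower bound c√ν (T−t)^{-1/2} (Leray
1934 §20); L³ must blow up (ESS 2003, Seregin 2012); only triple-log quantitative gain (Tao 2021). -/
@[route_item "route-NavierStokesRegularity-SqueezeCycle"]
def NoTypeII : Prop :=
  ∀ (ν T : ℝ), 0 < ν → 0 < T → ∀ (u : ℝ → EuclideanSpace ℝ (Fin 3) → EuclideanSpace ℝ (Fin 3)) (p : ℝ → EuclideanSpace ℝ (Fin 3) → ℝ), Literature.Analysis.FluidPDE.IsMaximalSmoothSolution ν 0 u p T → Literature.Analysis.FluidPDE.IsLerayHopfOn T ν 0 (u 0) u → Literature.Analysis.FluidPDE.HasRapidSpatialDecay (u 0) → Literature.Analysis.FluidPDE.IsTypeIBlowup u T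

/-- item stmt-NavierStokesRegularity-15368 · support · rank 3 · closed · proved by Summit.NavierStokesRegularity.NavierStokesRegularity.Theorems.squeezeCycle_singularProfileOfNontrivial_proof @ d156afb9559e (prover) · by planner
why it might fail: True in substance (A–B 2019 Thm 1.1 reverse); fails AS STATED only via bookkeeping: slab-wide 𝐈<⊤ needs the class-uniform (scaled) A–B Lemma 2.6 (tree: ball-wise, qualitative) and the KNSS pressure of a 𝒦_C member in L^{3/2} on balls touching t=0 (Morrey bound A ≤ C, not the rate).
sources: AlbrittonBarker2019, KNSS2009, Seregin2006, RusinSverak2011, Lin1998, arXiv:1811.00502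
[crux] BRIDGE 𝒦_C → Albritton–Barker local-energy class (strategist split of
ExtremalBiaxialitySubcritical, 2026-08-16; Albritton–Barker 2019 Thm 1.1, REVERSE direction, run
inside 𝒦_C). If a member u of 𝒦_C (the crux's inline Type-I KNSS-mild class: jointly smooth on t<0,
div-free, Oseen/KNSS-mild, rate ‖u(t,x)‖ ≤ C/√(−t), scaled energies A,E ≤ C) does not vanish
identically on t<0, then some suitable weak solution (w,q) on the slab ℝ³×(−∞,0) with weak gradient
H has 𝐈(ℝ³×ℝ₋) = typeIBound < ⊤, the SAME rate HasTypeITimeDecay C w, and a backward-singular ORIGIN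
— verbatim the hypotheses of RecurrentReduction. Proof plan (every tool is in tree): (i) u is
classical on Iio 0 for one pressure
(Theorems.exists_isClassicalNSSolutionOn_Iio_of_isTypeIAncientMild, via
isTypeIAncientMild_of_squeezeClass), hence suitable on the slab (Literature
isSuitableWeakSolutionOn_of_contDiffOn / IsClassicalNSSolutionOnRegion.isSuitableWeakSolutionOn)
with G = fderiv; A ≤ C, E ≤ 3C (Frobenius² ≤ 3·operator²), C-term ≤ 2C² (rate × A), mean-free
pressure term D bounded class-uniformly (A–B Lemma 2.6 A-case = albrittonBarker2019_lemma_2_6_holds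
on each ball; uniform over all balls by the scaling / translati -/
@[route_item "route-NavierStokesRegularity-SqueezeCycle"]
def SingularProfileOfNontrivial : Prop :=
  ∀ (C : ℝ) (u : ℝ → EuclideanSpace ℝ (Fin 3) → EuclideanSpace ℝ (Fin 3)), (ContDiffOn ℝ (⊤ : ℕ∞) (Function.uncurry u) (Set.Iio 0 ×ˢ Set.univ) ∧ (∀ t < 0, Literature.Analysis.FluidPDE.VectorCalculus.IsDivFree (u t)) ∧ (∀ s t : ℝ, s < t → t < 0 → ∀ x, u t x = Literature.Analysis.FluidPDE.heatFlow (u s) (t-s) x - ∫ τ in Set.Ioo s t, ∫ y, ((-(inner ℝ (x-y) (u τ y) / (2*(t-τ)) * Literature.Analysis.UnboundedOperators.heatKernel (t-τ) (x-y))) • u τ y + (∫ σ in Set.Ioi (t-τ), Literature.Analysis.UnboundedOperators.heatKernel σ (x-y) / (4*σ^2)) • (inner ℝ (x-y) (u τ y) • u τ y + inner ℝ (u τ y) (u τ y) • (x-y) + inner ℝ (x-y) (u τ y) • u τ y) - ((∫ σ in Set.Ioi (t-τ), Literature.Analysis.UnboundedOperators.heatKernel σ (x-y) / (8*σ^3))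 * (inner ℝ (x-y) (u τ y) * inner ℝ (x-y) (u τ y))) • (x-y))) ∧ Literature.Analysis.FluidPDE.HasTypeITimeDecay C u ∧ (∀ (x₀ : EuclideanSpace ℝ (Fin 3)) (t₀ r : ℝ), t₀ ≤ 0 → 0 < r → (∀ t, t₀ - r^2 < t → t < t₀ → r⁻¹ * ∫ x in Metric.ball x₀ r, ‖u t x‖^2 ≤ C) ∧ r⁻¹ * ∫ t in Set.Ioo (t₀ - r^2) t₀, ∫ x in Metric.ball x₀ r, ‖fderiv ℝ (u t) x‖^2 ≤ C)) → (∃ t : ℝ, t < 0 ∧ ∃ x : EuclideanSpace ℝ (Fin 3), u t x ≠ 0) → ∃ (w : ℝ → EuclideanSpace ℝ (Fin 3) → EuclideanSpace ℝ (Fin 3)) (q : ℝ → EuclideanSpace ℝ (Fin 3) → ℝ) (H : ℝ → EuclideanSpace ℝ (Fin 3) → EuclideanSpace ℝ (Fin 3) →L[ℝ] EuclideanSpace ℝ (Fin 3)), Literature.Analysis.FluidPDE.IsSuitableWeakSolutionOn (Literature.Analysis.FluidPDE.slab (EuclideanSpace ℝ (Fin 3)) (Set.Iio 0) isOpen_Iio)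 1 0 w q ∧ Literature.Analysis.FluidPDE.HasWeakSpatialGradientOn (Literature.Analysis.FluidPDE.slab (EuclideanSpace ℝ (Fin 3)) (Set.Iio 0) isOpen_Iio) w H ∧ Literature.Analysis.FluidPDE.typeIBound (Set.Iio (0 : ℝ) ×ˢ Set.univ) w q H < ⊤ ∧ Literature.Analysis.FluidPDE.HasTypeITimeDecay C w ∧ Literature.Analysis.FluidPDE.IsBackwardSingularPoint w 0

-- `SingularProfileOfNontrivial` holds: proved by `Summit.NavierStokesRegularity.NavierStokesRegularity.Theorems.squeezeCycle_singularProfileOfNontrivial_proof` @ d156afb9559e (its module imports this route file, so no `_holds` link can be stated here).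

/-- item stmt-NavierStokesRegularity-11611 · support · rank 4 · closed · proved by Summit.NavierStokesRegularity.NavierStokesRegularity.Theorems.extremalElementExists_proof (prover) · by planner
why it might fail: Closure of 𝒦_C under local limits needs the Oseen identity to pass to the limit with only the sup-rate and A, E (no pressure quantity D: AlbrittonBarker2019 Rem 3.2), and sup Λ < ∞ needs a gradient bound uniform over the class; either gap leaves the sup unattained.
sources: KNSS2009, AlbrittonBarker2019, SereginSverak2009, RusinSverak2011, Seregin2014Notes
[crux] (compactness of 𝒦_C; replaces the card's P3 'finitely many parts' by a pointwise extremal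
principle) if some u ∈ 𝒦_C has a point (t,x), t < 0, where Λ_u(t,x) ≤ 1/8 FAILS (negation of
MustSqueeze's hypothesis, verbatim), then there are u′ ∈ 𝒦_C (same C), m ≥ 1/8 and (t₀,x₀), t₀ < 0,
with Λ_{u′}(t₀,x₀) ≥ m and Λ_v(t,x) ≤ m for every v ∈ 𝒦_C, t < 0, x. Plan: M* := sup Λ over 𝒦_C ×
(−∞,0) × ℝ³ is finite by the KNSS gradient bound (−t)|∇v| ≤ C₁(C) (Prop 4.1 bootstrap in the Oseen
class); rescale a maximising sequence to (t,x) = (−1,0) (every clause of 𝒦_C is scaling- and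
translation-invariant), extract a C^∞_loc(t<0) limit from the uniform C^k bounds, pass to the limit
in the Oseen identity by dominated convergence (kernel bound (14)), in the decay and scaled-energy
clauses pointwise/by Fatou, in Λ by C¹_loc convergence and continuity of eigenvalues;
Courant–Fischer converts λ₂ ≤ m / ≥ m into the typed forms. [difficulty: L] -/
@[route_item "route-NavierStokesRegularity-SqueezeCycle"]
def ExtremalElementExists : Prop :=
  ∀ (C : ℝ) (u : ℝ → EuclideanSpace ℝ (Fin 3) → EuclideanSpace ℝ (Fin 3)), ContDiffOn ℝ (⊤ : ℕ∞) (Function.uncurry u) (Set.Iio 0 ×ˢ Set.univ) ∧ (∀ t < 0, Literature.Analysis.FluidPDE.VectorCalculus.IsDivFree (u t)) ∧ (∀ s t : ℝ, s < t → t < 0 → ∀ x, u t x = Literature.Analysis.FluidPDE.heatFlow (u s) (t-s) x - ∫ τ in Set.Ioo s t, ∫ y, ((-(inner ℝ (x-y) (u τ y) / (2*(t-τ)) * Literature.Analysis.UnboundedOperators.heatKernel (t-τ) (x-y))) • u τ y + (∫ σ in Set.Ioi (t-τ), Literature.Analysis.UnboundedOperators.heatKernel σ (x-y) / (4*σ^2))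 • (inner ℝ (x-y) (u τ y) • u τ y + inner ℝ (u τ y) (u τ y) • (x-y) + inner ℝ (x-y) (u τ y) • u τ y) - ((∫ σ in Set.Ioi (t-τ), Literature.Analysis.UnboundedOperators.heatKernel σ (x-y) / (8*σ^3)) * (inner ℝ (x-y) (u τ y) * inner ℝ (x-y) (u τ y))) • (x-y))) ∧ Literature.Analysis.FluidPDE.HasTypeITimeDecay C u ∧ (∀ (x₀ : EuclideanSpace ℝ (Fin 3)) (t₀ r : ℝ), t₀ ≤ 0 → 0 < r → (∀ t, t₀ - r^2 < t → t < t₀ → r⁻¹ * ∫ x in Metric.ball x₀ r, ‖u t x‖^2 ≤ C) ∧ r⁻¹ * ∫ t in Set.Ioo (t₀ - r^2) t₀, ∫ x in Metric.ball x₀ r, ‖fderiv ℝ (u t) x‖^2 ≤ C) → (∃ t : ℝ, t < 0 ∧ ∃ x : EuclideanSpace ℝ (Fin 3), ¬ (∃ v w : EuclideanSpace ℝ (Fin 3), ‖v‖ = 1 ∧ ‖w‖ = 1 ∧ inner ℝ v w = 0 ∧ ∀ α β : ℝ, (-t) * inner ℝ (fderiv ℝ (u t) x (α • v + β • w)) (α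 • v + β • w) ≤ (1 / 8 : ℝ) * (α^2 + β^2))) → ∃ (u' : ℝ → EuclideanSpace ℝ (Fin 3) → EuclideanSpace ℝ (Fin 3)) (m t₀ : ℝ) (x₀ : EuclideanSpace ℝ (Fin 3)), t₀ < 0 ∧ (ContDiffOn ℝ (⊤ : ℕ∞) (Function.uncurry u') (Set.Iio 0 ×ˢ Set.univ) ∧ (∀ t < 0, Literature.Analysis.FluidPDE.VectorCalculus.IsDivFree (u' t)) ∧ (∀ s t : ℝ, s < t → t < 0 → ∀ x, u' t x = Literature.Analysis.FluidPDE.heatFlow (u' s) (t-s) x - ∫ τ in Set.Ioo s t, ∫ y, ((-(inner ℝ (x-y) (u' τ y) / (2*(t-τ)) * Literature.Analysis.UnboundedOperators.heatKernel (t-τ) (x-y))) • u' τ y + (∫ σ in Set.Ioi (t-τ), Literature.Analysis.UnboundedOperators.heatKernel σ (x-y) / (4*σ^2)) • (inner ℝ (x-y) (u' τ y) • u' τ y + inner ℝ (u' τ y) (u' τ y) • (x-y) + inner ℝ (x-y) (u' τ y) • u' τ y) - ((∫ σ in Set.Ioi (t-τ), Literature.Analysis.UnboundedOperators.heatKernel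 σ (x-y) / (8*σ^3)) * (inner ℝ (x-y) (u' τ y) * inner ℝ (x-y) (u' τ y))) • (x-y))) ∧ Literature.Analysis.FluidPDE.HasTypeITimeDecay C u' ∧ (∀ (x₀ : EuclideanSpace ℝ (Fin 3)) (t₀ r : ℝ), t₀ ≤ 0 → 0 < r → (∀ t, t₀ - r^2 < t → t < t₀ → r⁻¹ * ∫ x in Metric.ball x₀ r, ‖u' t x‖^2 ≤ C) ∧ r⁻¹ * ∫ t in Set.Ioo (t₀ - r^2) t₀, ∫ x in Metric.ball x₀ r, ‖fderiv ℝ (u' t) x‖^2 ≤ C)) ∧ 1 / 8 ≤ m ∧ (∃ v w : EuclideanSpace ℝ (Fin 3), ‖v‖ = 1 ∧ ‖w‖ = 1 ∧ inner ℝ v w = 0 ∧ ∀ α β : ℝ, m * (α^2 + β^2) ≤ (-t₀) * inner ℝ (fderiv ℝ (u' t₀) x₀ (α • v + β • w)) (α • v + β • w)) ∧ (∀ v' : ℝ → EuclideanSpace ℝ (Fin 3) → EuclideanSpace ℝ (Fin 3), ContDiffOn ℝ (⊤ : ℕ∞) (Function.uncurry v') (Set.Iio 0 ×ˢ Set.univ)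 ∧ (∀ t < 0, Literature.Analysis.FluidPDE.VectorCalculus.IsDivFree (v' t)) ∧ (∀ s t : ℝ, s < t → t < 0 → ∀ x, v' t x = Literature.Analysis.FluidPDE.heatFlow (v' s) (t-s) x - ∫ τ in Set.Ioo s t, ∫ y, ((-(inner ℝ (x-y) (v' τ y) / (2*(t-τ)) * Literature.Analysis.UnboundedOperators.heatKernel (t-τ) (x-y))) • v' τ y + (∫ σ in Set.Ioi (t-τ), Literature.Analysis.UnboundedOperators.heatKernel σ (x-y) / (4*σ^2)) • (inner ℝ (x-y) (v' τ y) • v' τ y + inner ℝ (v' τ y) (v' τ y) • (x-y) + inner ℝ (x-y) (v' τ y) • v' τ y) - ((∫ σ in Set.Ioi (t-τ), Literature.Analysis.UnboundedOperators.heatKernel σ (x-y) / (8*σ^3)) * (inner ℝ (x-y) (v' τ y) * inner ℝ (x-y) (v' τ y))) • (x-y))) ∧ Literature.Analysis.FluidPDE.HasTypeITimeDecay C v' ∧ (∀ (x₀ : EuclideanSpace ℝ (Fin 3)) (t₀ r : ℝ), t₀ ≤ 0 → 0 < r → (∀ t, t₀ - r^2 < t → t < t₀ → r⁻¹ * ∫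 x in Metric.ball x₀ r, ‖v' t x‖^2 ≤ C) ∧ r⁻¹ * ∫ t in Set.Ioo (t₀ - r^2) t₀, ∫ x in Metric.ball x₀ r, ‖fderiv ℝ (v' t) x‖^2 ≤ C) → ∀ t < 0, ∀ x, (∃ v w : EuclideanSpace ℝ (Fin 3), ‖v‖ = 1 ∧ ‖w‖ = 1 ∧ inner ℝ v w = 0 ∧ ∀ α β : ℝ, (-t) * inner ℝ (fderiv ℝ (v' t) x (α • v + β • w)) (α • v + β • w) ≤ m * (α^2 + β^2)))

-- `ExtremalElementExists` holds: proved by `Summit.NavierStokesRegularity.NavierStokesRegularity.Theorems.extremalElementExists_proof` (its module imports this route file, so no `_holds` link can be stated here).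

/-- item stmt-NavierStokesRegularity-0055 · support · rank 9 · closed · proved by Summit.NavierStokesRegularity.NavierStokesRegularity.Theorems.typeICertificateLadder_noBlowupToClay_proof @ 8d57e70af7e2 (prover) · by planner
sources: Leray1934, FujitaKato1964, Fefferman2000
Given NoBlowup, build the Clay (A) solution: local finite-energy classical solution for smooth
divergence-free rapidly decaying data (Leray 1934 §III / Fujita–Kato 1964 + LPS smoothing), continue
past every T using NoBlowup, glue by weak–strong uniqueness (Prodi–Serrin), bounded energy from the
energy inequality, and convert with
Literature.Analysis.FluidPDE.isNavierStokesSolution_and_smooth_iff. Blow-up at spatial infinity is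
excluded by CKN ε-regularity applied far out. May take named Literature facts (leray_existence_R3,
ladyzhenskaya_prodi_serrin, weak_strong_uniqueness, fujita_kato_local) as hypotheses if the grounder
so rules. -/
@[route_item "route-NavierStokesRegularity-SqueezeCycle"]
def NoBlowupToClay : Prop :=
  (∀ (ν T : ℝ), 0 < ν → 0 < T → ∀ (u : ℝ → EuclideanSpace ℝ (Fin 3) → EuclideanSpace ℝ (Fin 3)) (p : ℝ → EuclideanSpace ℝ (Fin 3) → ℝ), Literature.Analysis.FluidPDE.IsClassicalNSSolutionOn (Set.Ico 0 T) ν 0 u p → Literature.Analysis.FluidPDE.IsLerayHopfOn T ν 0 (u 0) u → Literature.Analysis.FluidPDE.HasRapidSpatialDecay (u 0) → Literature.Analysis.FluidPDE.HasSmoothExtensionPast ν 0 u T) → NavierStokesRegularity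

/-- `NoBlowupToClay` holds: proved by `Summit.NavierStokesRegularity.NavierStokesRegularity.Theorems.typeICertificateLadder_noBlowupToClay_proof` @ 8d57e70af7e2. -/
theorem NoBlowupToClay_holds : NoBlowupToClay := _root_.Summit.NavierStokesRegularity.NavierStokesRegularity.Theorems.typeICertificateLadder_noBlowupToClay_proof

/-- item stmt-NavierStokesRegularity-10573 · support · rank 9 · closed · proved by Summit.NavierStokesRegularity.NavierStokesRegularity.Theorems.singularZoom_proof (prover) · by planner
sources: AlbrittonBarker2019, RusinSverak2011, KNSS2009, SereginSverak2009, CKN1982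
[support] (glue, KNOWN: AlbrittonBarker2019 §3 forward direction + KNSS2009 §6) X_sing ⇒ a
finite-energy classical solution on [0,T) from a rapidly decaying datum with Type-I rate near T
extends smoothly past T. If not, u is unbounded near T (continuation), the singular set at time T is
a nonempty compact set (far-field ε-regularity, CKN1982), pick a singular point (x₀,T); the zooms
u_k(x,t) = λ_k u(x₀+λ_k x, T+λ_k² t), λ_k ↓ 0 (NO sup-normalisation) keep the sup-rate constant,
inherit scale-invariant energies from 𝐈(Q((x₀,T),ρ)) < ∞ (AlbrittonBarker2019 Lemma 2.5 'weak Serrin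
⇒ Type I', u ∈ L^{2,∞}_t L^∞_x), converge in C^∞_loc(t<0) by KNSS2009 Prop 4.1 bounds to a KNSS-mild
limit ū (dominated convergence in the Oseen identity, kernel bound (14)) which is in the Type-I
class with constant max(C, C′) and singular at (0,0) by persistence of singularities
(RusinSverak2011; AlbrittonBarker2019 Prop 2.3) — contradicting X_sing. May take named facts
(knss2009_smoothing, hasSmoothExtensionPast_of_bounded, CKN ε-regularity) as hypotheses if the
grounder so rules. [difficulty: L] [rev 2, cone repair: the KNSS-mild Oseen clause is unchanged in
meaning — `oseenKernel (t−τ) (x−y) (u τ y) (u τ -/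
@[route_item "route-NavierStokesRegularity-SqueezeCycle"]
def SingularZoom : Prop :=
  (∀ (C : ℝ) (u : ℝ → EuclideanSpace ℝ (Fin 3) → EuclideanSpace ℝ (Fin 3)), ContDiffOn ℝ (⊤ : ℕ∞) (Function.uncurry u) (Set.Iio 0 ×ˢ Set.univ) ∧ (∀ t < 0, Literature.Analysis.FluidPDE.VectorCalculus.IsDivFree (u t)) ∧ (∀ s t : ℝ, s < t → t < 0 → ∀ x, u t x = Literature.Analysis.FluidPDE.heatFlow (u s) (t - s) x - ∫ τ in Set.Ioo s t, ∫ y, ((-(inner ℝ (x - y) (u τ y) / (2 * (t - τ)) * Literature.Analysis.UnboundedOperators.heatKernel (t - τ) (x - y))) • u τ y + (∫ σ in Set.Ioi (t - τ), Literature.Analysis.UnboundedOperators.heatKernel σ (x - y) / (4 * σ ^ 2)) • (inner ℝ (x - y) (u τ y) • u τ y + inner ℝ (u τ y) (u τ y) • (x - y) + inner ℝ (x - y) (u τ y) • u τ y) - ((∫ σ in Set.Ioi (t - τ), Literature.Analysis.UnboundedOperators.heatKernel σ (x - y) / (8 * σ ^ 3)) * (inner ℝ (x - y) (u τ y) * inner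 ℝ (x - y) (u τ y))) • (x - y))) ∧ Literature.Analysis.FluidPDE.HasTypeITimeDecay C u ∧ (∀ (x₀ : EuclideanSpace ℝ (Fin 3)) (t₀ r : ℝ), t₀ ≤ 0 → 0 < r → (∀ t, t₀ - r ^ 2 < t → t < t₀ → r⁻¹ * ∫ x in Metric.ball x₀ r, ‖u t x‖ ^ 2 ≤ C) ∧ r⁻¹ * ∫ t in Set.Ioo (t₀ - r ^ 2) t₀, ∫ x in Metric.ball x₀ r, ‖fderiv ℝ (u t) x‖ ^ 2 ≤ C) → ¬ (∀ r > 0, ∀ M : ℝ, ∃ t ∈ Set.Ioo (-(r ^ 2)) (0 : ℝ), ∃ x ∈ Metric.ball (0 : EuclideanSpace ℝ (Fin 3)) r, M < ‖u t x‖)) → ∀ (ν T : ℝ), 0 < ν → 0 < T → ∀ (u : ℝ → EuclideanSpace ℝ (Fin 3) → EuclideanSpace ℝ (Fin 3)) (p : ℝ → EuclideanSpace ℝ (Fin 3) → ℝ), Literature.Analysis.FluidPDE.IsClassicalNSSolutionOn (Set.Ico 0 T) ν 0 u p → Literature.Analysis.FluidPDE.IsLerayHopfOn T ν 0 (u 0)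 u → Literature.Analysis.FluidPDE.HasRapidSpatialDecay (u 0) → Literature.Analysis.FluidPDE.IsTypeIBlowup u T → Literature.Analysis.FluidPDE.HasSmoothExtensionPast ν 0 u T

-- `SingularZoom` holds: proved by `Summit.NavierStokesRegularity.NavierStokesRegularity.Theorems.singularZoom_proof` (its module imports this route file, so no `_holds` link can be stated here).

/-- item stmt-NavierStokesRegularity-11612 · support · rank 9 · closed · proved by Summit.NavierStokesRegularity.NavierStokesRegularity.Theorems.signLaw_proof (prover) · by planner
sources: doi:10.1017/S0022112056000317, Miller2019
[support] (card P1, the pointwise identity) for a trace-free real 3×3 matrix A (velocity gradient, A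
i j = ∂ⱼuᵢ) with ω = (A₂₁−A₁₂, A₀₂−A₂₀, A₁₀−A₀₁) (= curl u) and S = ½(A + Aᵀ): ω·Sω = 4 det A − 4
det S (Cayley–Hamilton tr A³ = 3 det A on sl(3), tr A³ = tr S³ + ¾ ω·Sω; Betchov 1956). Checked
numerically to 1e−14 in-session; a `Matrix.det_fin_three` + `ring` exercise. [difficulty:
provable-now] -/
@[route_item "route-NavierStokesRegularity-SqueezeCycle"]
def SignLaw : Prop :=
  ∀ A : Matrix (Fin 3) (Fin 3) ℝ, A.trace = 0 → ![A 2 1 - A 1 2, A 0 2 - A 2 0, A 1 0 - A 0 1] ⬝ᵥ (((1 / 2 : ℝ) • (A + Aᵀ)) *ᵥ ![A 2 1 - A 1 2, A 0 2 - A 2 0, A 1 0 - A 0 1]) = 4 * A.det - 4 * (((1 / 2 : ℝ) • (A + Aᵀ))).det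

/-- `SignLaw` holds: proved by `Summit.NavierStokesRegularity.NavierStokesRegularity.Theorems.signLaw_proof`. -/
theorem SignLaw_holds : SignLaw := _root_.Summit.NavierStokesRegularity.NavierStokesRegularity.Theorems.signLaw_proof

/-- item stmt-NavierStokesRegularity-11613 · support · rank 9 · closed · proved by Summit.NavierStokesRegularity.NavierStokesRegularity.Theorems.middleEigenvalueSign_proof (prover) · by planner
sources: Miller2019, NeustupaPenel2001
[support] (card P1, the sign) for trace-free A and S = ½(A + Aᵀ), with μ₀ ≥ μ₁ ≥ μ₂ the eigenvalues
of A + Aᵀ = 2S (`Matrix.IsHermitian.eigenvalues₀`, antitone): −4 det S = ½ μ₁ |μ₀| |μ₂| — the local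
part of enstrophy production carries the sign of the MIDDLE eigenvalue (det = product of
eigenvalues; trace zero forces μ₀ ≥ 0 ≥ μ₂). [difficulty: provable-now] -/
@[route_item "route-NavierStokesRegularity-SqueezeCycle"]
def MiddleEigenvalueSign : Prop :=
  ∀ A : Matrix (Fin 3) (Fin 3) ℝ, A.trace = 0 → -4 * (((1 / 2 : ℝ) • (A + Aᵀ))).det = (1 / 2) * (Matrix.isHermitian_add_transpose_self A).eigenvalues₀ 1 * |(Matrix.isHermitian_add_transpose_self A).eigenvalues₀ 0| * |(Matrix.isHermitian_add_transpose_self A).eigenvalues₀ 2|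

/-- `MiddleEigenvalueSign` holds: proved by `Summit.NavierStokesRegularity.NavierStokesRegularity.Theorems.middleEigenvalueSign_proof`. -/
theorem MiddleEigenvalueSign_holds : MiddleEigenvalueSign := _root_.Summit.NavierStokesRegularity.NavierStokesRegularity.Theorems.middleEigenvalueSign_proof

/-- item stmt-NavierStokesRegularity-11614 · support · rank 9 · closed · proved by Summit.NavierStokesRegularity.NavierStokesRegularity.Theorems.shearEndpoint_proof (prover) · by planner
sources: doi:10.1016/0378-4371(84)90008-6, doi:10.1063/1.858295, BuariaPumirBodenschatz2020
[support] (card P2, 'shear endpoint inequality') on sl(3,ℝ): (ω·Sω)² ≤ (36/25)·‖A‖_F²·‖A²‖_F², i.e.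
|ω·Sω| ≤ (6/5)‖A‖_F‖A²‖_F (sharp constant 1.06603 by in-session random search + hill-climb, refuter
audit 1.06604; equality set of the zero locus: A² = 0, the rank-one shears a⊗b, a·b = 0, on which ω
is the null vector of S). A degree-6 polynomial inequality in 8 variables: SOS certificate /
certified numerics, or the tangent-space argument ker(H ↦ NH + HN) = T_N{A² = 0} (dim 4) +
compactness. [difficulty: M] -/
@[route_item "route-NavierStokesRegularity-SqueezeCycle"]
def ShearEndpoint : Prop :=
  ∀ A : Matrix (Fin 3) (Fin 3) ℝ, A.trace = 0 → (![A 2 1 - A 1 2, A 0 2 - A 2 0, A 1 0 - A 0 1] ⬝ᵥ (((1 / 2 : ℝ) • (A + Aᵀ)) *ᵥ ![A 2 1 - A 1 2, A 0 2 - A 2 0, A 1 0 - A 0 1])) ^ 2 ≤ (36 / 25) * (∑ i, ∑ j, (A) i j ^ 2) * (∑ i, ∑ j, (A * A) i j ^ 2)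

/-- `ShearEndpoint` holds: proved by `Summit.NavierStokesRegularity.NavierStokesRegularity.Theorems.shearEndpoint_proof`. -/
theorem ShearEndpoint_holds : ShearEndpoint := _root_.Summit.NavierStokesRegularity.NavierStokesRegularity.Theorems.shearEndpoint_proof

/-- item stmt-NavierStokesRegularity-11615 · support · rank 9 · closed · proved by Summit.NavierStokesRegularity.NavierStokesRegularity.Theorems.biaxialityDefect_proof (prover) · by planner
sources: doi:10.1016/0378-4371(84)90008-6, BuariaPumirBodenschatz2020, Miller2019
[support] (new lemma found while typing the route; the algebraic half of card K1) for trace-free A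
with μ = eigenvalues of A + Aᵀ (antitone): μ₁²·‖A‖_F² ≤ (144/25)·‖A²‖_F², i.e. |λ₂(S)| ≤
(6/5)·‖A²‖_F/‖A‖_F (sharp constant 1.0234 by in-session search, stable near the nilpotent variety):
the middle strain eigenvalue is controlled by the NILPOTENCY DEFECT, so a biaxially strained point
(Λ ≥ a) has gauge defect (−t)²‖A²‖_F ≥ (5a/6)(−t)‖A‖_F — near-nilpotent (flattened-layer) gradients
are never squeeze sites. Same proof technology as ShearEndpoint (degree-4×2 polynomial inequality
via `Matrix.IsHermitian` spectral theorem, or SOS on the characteristic polynomial). [difficulty: M] -/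
@[route_item "route-NavierStokesRegularity-SqueezeCycle"]
def BiaxialityDefect : Prop :=
  ∀ A : Matrix (Fin 3) (Fin 3) ℝ, A.trace = 0 → ((Matrix.isHermitian_add_transpose_self A).eigenvalues₀ 1) ^ 2 * (∑ i, ∑ j, (A) i j ^ 2) ≤ (144 / 25) * (∑ i, ∑ j, (A * A) i j ^ 2)

/-- `BiaxialityDefect` holds: proved by `Summit.NavierStokesRegularity.NavierStokesRegularity.Theorems.biaxialityDefect_proof`. -/
theorem BiaxialityDefect_holds : BiaxialityDefect := _root_.Summit.NavierStokesRegularity.NavierStokesRegularity.Theorems.biaxialityDefect_proof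

/-- item stmt-NavierStokesRegularity-15364 · support · rank 9 · closed · proved by Summit.NavierStokesRegularity.NavierStokesRegularity.Theorems.recurrentBridge_proof @ 82d4a2726134 (prover) · by planner
[support] GLUE (route-repair 2026-08-16, registering strategist cstrat-11609's recurrent
decomposition of the heart; `route edit --split` is final-cycle-only, so the decomposition is filed
flat): SingularProfileOfNontrivial → RecurrentLiouville → ExtremalBiaxialitySubcritical. Proof (≈10
lines, PROVABLE NOW): given a record configuration (C, m, u, t₀, x₀) of
ExtremalBiaxialitySubcritical, u ∈ 𝒦_C vanishes identically on t<0 — else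
SingularProfileOfNontrivial gives an origin-singular Albritton–Barker slab profile (w,q,H) with
typeIBound < ⊤ and the same rate, the PROVED item stmt-NavierStokesRegularity-1590
`RecurrentProfiles.RecurrentReduction`
(Summit.NavierStokesRegularity.NavierStokesRegularity.Theorems.recurrentReduction_proof, axioms
propext/Classical.choice/Quot.sound) upgrades it to a uniformly recurrent origin-singular profile,
and RecurrentLiouville says that one is regular at the origin, absurd; then the two-frame record
inequality for the zero field (fderiv of a constant = 0) reads m·(1²+0²) ≤ 0, so m ≤ 0 < 1/8.
Kernel-checked verbatim in the planner's Sketch.lean (`recurrentBridge₂_holds`, via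
`recurrentBridge_holds : SPoN → (1590 verbatim) → RL → EBS`; lean rc 0, 0 sor -/
@[route_item "route-NavierStokesRegularity-SqueezeCycle"]
def RecurrentBridge : Prop :=
  Summit.NavierStokesRegularity.NavierStokesRegularity.Theses.SqueezeCycle.SingularProfileOfNontrivial → Summit.NavierStokesRegularity.NavierStokesRegularity.Theses.SqueezeCycle.RecurrentLiouville → Summit.NavierStokesRegularity.NavierStokesRegularity.Theses.SqueezeCycle.ExtremalBiaxialitySubcritical

-- `RecurrentBridge` holds: proved by `Summit.NavierStokesRegularity.NavierStokesRegularity.Theorems.recurrentBridge_proof` @ 82d4a2726134 (its module imports this route file, so no `_holds` link can be stated here).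

-- earlier Assembly (stmt-NavierStokesRegularity-11616, replaced 2026-08-15T22:52:30Z -> stmt-NavierStokesRegularity-13913): proved by Summit.NavierStokesRegularity.NavierStokesRegularity.Theorems.squeezeCycle_assembly_proof @ 3cd1af751cda — MustSqueeze → ExtremalElementExists → ExtremalBiaxialitySubcritical → SingularZoom → NoTypeII → NoBlowupToClay → NavierStokesRegularity
/-- item stmt-NavierStokesRegularity-13913 · assembly · rank 1 · closed · proved by Summit.NavierStokesRegularity.NavierStokesRegularity.Theorems.squeezeCycle_assembly_frame_proof (prover) · by planner
sources: Fefferman2000, KNSS2009, AlbrittonBarker2019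
[assembly] MustSqueeze → ExtremalElementExists → ExtremalBiaxialitySubcritical → SingularZoom →
NoTypeII → NoBlowupToClay → NavierStokesRegularity (the deciding theorem `closes`, curried).
Re-filed 2026-08-15 by route-repair with fully-qualified names only; logically and definitionally
identical to the earlier Assembly stmt-NavierStokesRegularity-11616, which is PROVED
(Theorems.squeezeCycle_assembly_proof @ 9b8096418930) — its `Assembly_holds` link made the renderer
auto-import Summits.…Theorems.SqueezeCycleAssembly, a module that imports THIS route module (import
cycle ⇒ the route file could not be materialised, glue FAIL). PROVERS: nothing to prove here — do
NOT land another proof against this decl (that re-creates the cycle); the operator closes it `--by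
…Theorems.squeezeCycle_assembly_proof` once the gate resolver skips modules that import the route.
Any proof of ANY item of this route should, until then, live in a module that does not import this
Theses file (restate the Prop verbatim, cf. Theorems/BlowupAssembly.lean), or the route breaks
again. -/
@[route_item "route-NavierStokesRegularity-SqueezeCycle"]
def Assembly : Prop :=
  Summit.NavierStokesRegularity.NavierStokesRegularity.Theses.SqueezeCycle.MustSqueeze → Summit.NavierStokesRegularity.NavierStokesRegularity.Theses.SqueezeCycle.ExtremalElementExists → Summit.NavierStokesRegularity.NavierStokesRegularity.Theses.SqueezeCycle.ExtremalBiaxialitySubcritical → Summit.NavierStokesRegularity.NavierStokesRegularity.Theses.SqueezeCycle.SingularZoom → Summit.NavierStokesRegularity.NavierStokesRegularity.Theses.SqueezeCycle.NoTypeII → Summit.NavierStokesRegularity.NavierStokesRegularity.Theses.SqueezeCycle.NoBlowupToClay → _root_.NavierStokesRegularity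

/-- `Assembly` holds: proved by `Summit.NavierStokesRegularity.NavierStokesRegularity.Theorems.squeezeCycle_assembly_frame_proof`. -/
theorem Assembly_holds : Assembly := _root_.Summit.NavierStokesRegularity.NavierStokesRegularity.Theorems.squeezeCycle_assembly_frame_proof

/-! D-0027 §2.1 — DECIDING THEOREM (planner-authored via `route open/edit --closes-file`; by planner-rglue-NavierStokesRegularity-SqueezeC-8984262a-0 2026-08-15T22:52:30Z):
its hypotheses are this route's items and its conclusion the sub-problem Statement (glue_lint), and it elaborates with this file. -/

/-- D-0027 §2.1 deciding theorem for route SqueezeCycle: the cruxes decide Clay (A).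
Step 1 (the card's dichotomy, pure logic): for `u ∈ 𝒦_C` either the Leray-gauge middle strain eigenvalue is
`≤ 1/8` at every point — then `MustSqueeze` gives `u ≡ 0` — or some point violates it; then
`ExtremalElementExists` produces an extremal configuration `(u', m ≥ 1/8, (t₀, x₀))` and
`ExtremalBiaxialitySubcritical` gives `m < 1/8`, absurd. Hence `SqueezeLiouville` (target, not a hypothesis).
Step 2 (shared tail of route ClockStretchingLaw): `NoBlowupToClay` reduces Clay (A) to continuation past every
`T`; a non-extendable finite-energy classical solution from a rapidly decaying datum is maximal, `NoTypeII` gives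
the Type-I rate, and `SingularZoom` needs only "no singular element of 𝒦_C", which the Liouville statement gives
(a field vanishing on `t < 0` is bounded in every parabolic cylinder) — contradiction. The four algebra supports
(`SignLaw`, `MiddleEigenvalueSign`, `ShearEndpoint`, `BiaxialityDefect`) are engines of the cruxes, not hypotheses. -/
@[closes "route-NavierStokesRegularity-SqueezeCycle"] theorem closes (hM : MustSqueeze) (hE : ExtremalElementExists) (hX : ExtremalBiaxialitySubcritical)
    (hZ : SingularZoom) (hII : NoTypeII) (hClay : NoBlowupToClay) : _root_.NavierStokesRegularity := by
  -- Step 1 (the card's dichotomy, pure logic): Liouville on the Type-I model class 𝒦_C.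
  have hL : SqueezeLiouville := by
    intro C u hu
    by_cases h : ∀ t < 0, ∀ x, (∃ v w : EuclideanSpace ℝ (Fin 3), ‖v‖ = 1 ∧ ‖w‖ = 1 ∧ inner ℝ v w = 0 ∧ ∀ α β : ℝ, (-t) * inner ℝ (fderiv ℝ (u t) x (α • v + β • w)) (α • v + β • w) ≤ (1 / 8 : ℝ) * (α^2 + β^2))
    · exact hM C u hu h
    · have h' : ∃ t : ℝ, t < 0 ∧ ∃ x : EuclideanSpace ℝ (Fin 3), ¬ (∃ v w : EuclideanSpace ℝ (Fin 3), ‖v‖ = 1 ∧ ‖w‖ = 1 ∧ inner ℝ v w = 0 ∧ ∀ α β : ℝ, (-t) * inner ℝ (fderiv ℝ (u t) x (α • v + β • w)) (α • v + β • w) ≤ (1 / 8 : ℝ) * (α^2 + β^2)) := by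
        by_contra hcon
        apply h
        intro t ht x
        by_contra hx
        exact hcon ⟨t, ht, x, hx⟩
      obtain ⟨u', m, t₀, x₀, ht₀, hu', hm, hGE, hmax⟩ := hE C u hu h'
      have hlt : m < 1 / 8 := hX C m u' t₀ x₀ ht₀ hu' hGE hmax
      exact absurd hm (not_le.mpr hlt)
  -- Step 2 (known tail shared with route ClockStretchingLaw): no singular Type-I model, zoom, Type-I rate, Clay (A).
  apply hClay
  intro ν T hν hT u p hcl hLH hdec
  by_contra hext
  have hTI : Literature.Analysis.FluidPDE.IsTypeIBlowup u T := hII ν T hν hT u p ⟨hcl, hext⟩ hLH hdec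
  refine hext (hZ ?_ ν T hν hT u p hcl hLH hdec hTI)
  intro C v hv hsing
  obtain ⟨t, ht, x, hx, hlt⟩ := hsing 1 one_pos 0
  have h0 : v t x = 0 := hL C v hv t ht.2 x
  rw [h0, norm_zero] at hlt
  exact lt_irrefl _ hlt

end Summit.NavierStokesRegularity.NavierStokesRegularity.Theses.SqueezeCycle
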